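import Literature.Probability.FitznerVanDerHofstad2017.NoblePercolationSplit
import Literature.Probability.FitznerVanDerHofstad2017.NobleRemainderBound
import Literature.Barriers.CriticalPhenomena.GaussianDominationRouteDiagramsProofs
import Literature.Probability.Percolation.BKFinitary
import Literature.Probability.Percolation.BernoulliPercolation
import Literature.Probability.LatticeModels.PerfectMatchingCount
import HarnessLib

/-!
# [FvdH17] §4.2–4.3 for `N = 0`: the simple diagrams `τ_{m,p}`, `𝓓_{j₁,j₂}` and Lemmas 4.2, 4.3

Source: R. Fitzner, R. van der Hofstad, *Mean-field behavior for nearest-neighbor percolation in `d > 10`*,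
Electron. J. Probab. **22** (2017) no. 43 [FvdH17]; displays are numbered as in arXiv:1506.07977v2 (= EJP
numbering), pages given for both.  This module types, for the tree's NoBLE coefficients at `N = 0`
(`nobleXiN d p 0`, `nobleXiIotaN d p (𝐞 ι) 0`, `noblePsiN`, `noblePiN … 0`, `LaceExpansionNobleCoefficients`) and the
percolation split `percolationNobleSplit d p hd hp` of §3.4 (`NoblePercolationSplit`), the "simple diagrams" of
§4.2 and the two `N = 0` lemmas of §4.3:

* §4.2 (4.1) `τ_{m,p}(x) = P_p(0 ←m→ x)` (`tauGe`) and (4.12) `𝓓_{j₁,j₂}(x) = P_p({0 ←j₁→ x} ∘ {0 ←j₂→ x})`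
  (`diagDT`, real version `diagD`), with the event `{v ←m→ x}` = `openConnGe m v x` and the BK bound
  `𝓓_{j₁,j₂}(x) ≤ τ_{j₁}(x) τ_{j₂}(x)` (`diagD_le_tauGe_mul`, from `bk_finitary`);
* Lemma 4.2 (`lemmapercboundXi0`; arXiv v2 p. 37, EJP p. 34), displays (4.22)–(4.27);
* Lemma 4.3 (`lemmapercboundXiiota0`; arXiv v2 pp. 37–38, EJP pp. 34–35), displays (4.28)–(4.39).

## What is KERNEL-PROVED here (no hypotheses beyond `2 ≤ d`, `p < p_c` where the split needs them)

* (4.22), as termwise EQUALITIES: `Ξ^{(0)}_p(x) = 𝓓_{1,1}(x)` (`nobleXiN_zero_eq_diagD`; both vanish at `x = 0`,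
  and for `x ≠ 0` `{0 ⇔ x} = E'(0,x;ℤ^d)` is, up to the null set of non-lattice configurations, the disjoint
  occurrence `{0 ←1→ x} ∘ {0 ←1→ x}` by Menger), hence both sums of (4.22) (`FvdH17_L42_d422a/b`, `SumLE` transfers).
* (4.23): `Ξ^{(0)}_{R,p}(x) ≤ 𝓓_{2,2}(x)` termwise (`percolationNobleSplit_xiR_zero_le_diagD`: off the direct bond a
  double connection consists of two bond-disjoint simple paths of length `≥ 2`), hence (4.23) in transfer form
  (`FvdH17_L42_d423a/b`).
* (4.49): `Ξ^{(0),ι}_p(e_ι) = τ_{3,p}(e_1)` and `Ξ^{(0),ι}_p(0) = 0` (`nobleXiIotaN_zero_at_self/_at_zero`; the first via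
  `E'(0,e;{e}) = {0 ↔ e}`, the parity of `ℤ^d` — an open path `0 → e_ι` avoiding `(0,e_ι)` has odd length `≥ 3` — and
  the signed-permutation symmetry `τ_{3,p}(e_ι) = τ_{3,p}(e_1)`).
* (4.31): `Ξ^{(0),ι}_{α,I,p}(e_ι) = τ_{3,p}(e_1)` (so `≤`, `FvdH17_L43_d431a`), `Ξ^{(0),ι}_{α,II,p}(0) = 0` (`…d431b`), and the
  third item in the shape `Σ_κ Ξ^{(0),ι}_{α,II,p}(e_κ) = τ_{3,p}(e_1)` for every `ι` (`…d431c`) — see DIVERGENCES.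
* (4.32) in the shape `Σ_κ Ξ^{(0),ι}_{α,I,p}(e_ι + e_κ) ≤ (2d−1)·p·τ_{3,p}(e_1)²` for every `ι` (`FvdH17_L43_d432`; BK for
  the three bond-disjoint increasing events `{0 ↔ e_ι off (0,e_ι)}`, `{e_ι ↔ x off (e_ι,x)}`, `{(e_ι,x) occupied}`,
  parity twice, and `κ = −ι` contributing `0`).
* The overcounting bound behind (4.37): `Σ_κ Π^{(0),ι,κ}_{α,p}(e_ι) ≤ (2d−2)·p·τ_{3,p}(e_1)` for every `ι`
  (`FvdH17_L43_piAlpha_sum_le`): on every lattice configuration at most `2d−2` directions `κ` realise the event of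
  `Π^{(0),ι,κ}(e_ι)` (`card_le_of_forall_mem_piZeroEvent`), integrated (`sum_measure_piZeroEvent_le`), times
  `P_p(0 ↔ e_ι off (0,e_ι)) = τ_{3,p}(e_1)`.

## What is a NAMED FACT here (verbatim published display, transfer form; section H)

(4.25), (4.26), (4.27) of Lemma 4.2; (4.28), (4.29), (4.30), (4.33), (4.34), (4.35), (4.36), (4.38), (4.39) of Lemma 4.3;
and the proof display (4.53) (the per-`κ` form of (4.38)).  Each docstring quotes the display, names the tree objects
it is read over, and records why the PRINTED proof is sound for it.  They are `def … : Prop` to be used as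
hypotheses `(h : FvdH17_L4x_d4nn d p hd hp)`; nothing in this module assumes them.

## What is deliberately NOT typed

* (4.24) `Σ_x Ψ^{(0),κ}_{R,I,p}(x) ≤ (2d−2)p τ_{3,p}(e_1) + min{1,(p/μ_p)(d−1)/d} Σ_x 𝓓_{2,2}(x)`: the printed decomposition
  (4.46) of `(μ_p/p)Ψ^{(0),κ}_{R,I}(x)` lists the regimes `‖x−e_κ‖₁ > 1`, `x = e_κ`, `‖x−e_κ‖₁ = 1`, and the bound (4.47)
  then covers `x ∉ {−e_κ, e_κ}` plus the `x = e_κ` term; we could not match the term `x = −e_κ` (where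
  `‖x − e_κ‖₁ = 2 > 1` and a two-step connection `0 ←2→ −e_κ` is possible) to either printed summand with the printed
  constant, so the display is left to a later revision rather than asserted.  (Programme packet: GAPS/DIVERGENCE.)
* (4.37) as printed, `Σ_κ Π^{(0),ι,κ}_{α,p}(e_1) ≤ 2(d−1) μ_p τ_{3,p}(e_1)` (TeX `\aap` = `μ_p`): the printed argument
  ("`Π^{(0),ι,κ}_p(e_ι) ≤ μ_p τ_{3,p}(e_1)` by Harris", then overcounting) is not reproduced here — Harris applied to
  `p·P({0 ↔ e_ι} ∩ {decreasing} | (0,e_ι) vacant)` gives `p τ_{3,p}(e_1) · P(decreasing | vacant)` and we do not see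
  why the last factor is `≤ μ_p/p = P(e_1 ∉ C̃^{(0,e_1)}(0))` (conditioning on a further vacant bond can only increase
  a decreasing event's probability).  What the overcounting argument does give, `(2d−2)·p·τ_{3,p}(e_1)` — the value
  `Bound[Pi,alpha,0] = (2d-2) z G₃` of the authors' notebook — is kernel-proved (`FvdH17_L43_piAlpha_sum_le`).  Also the
  printed argument `e_1` of `Π_α` is read as `e_ι` (`Π^{(0),ι,κ}_α(x) = δ_{x,e_ι} Π^{(0),ι,κ}(x)` vanishes at `e_1` unless
  `e_ι = e_1`).

## READINGS (decisions made in typing; each flagged where used)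

* PATH READING of `{v ←m→ x}` ("connected by a path of occupied bonds of at least `m` steps", §4.2 above (4.1)):
  a *vertex-simple* open path (`SimpleGraph.Walk.IsPath`) of length `≥ m`.  Evidence that this is the authors'
  reading: (4.49) `Ξ^{(0),ι}(0) = 0` and (4.40)/(4.22) `Ξ^{(0)}_R(x) = (1−δ_{0,x})P({0 ←2→ x}∘{x ←2→ 0})` require
  `{v ←m→ v} = ∅` for `m ≥ 1` (`openConnGe_self_eq_empty`), false for trails/walks; and the parity identity
  `P(0 ↔ e_ι off (0,e_ι)) = τ_{3,p}(e_ι)` (4.49) holds verbatim for simple paths (`measure_sdiff_mem_openConn_eq`).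
  Under this reading `τ_{0,p} = τ_p` (`openConnGe_zero`), `τ_{1,p}(x) = τ_p(x)` for `x ≠ 0` (`openConnGe_one_eq`).
* `∘` in (4.12) is bond-disjoint occurrence, the tree's `disjointOccurrence (□)` on bond configurations
  (`Percolation.BKFinitary`), as in [FvdH17] §4.2 ("these paths consist of disjoint bonds").
* `e_ι`, `ι ∈ {±1,…,±d}` is `𝐞 ι = stepVec ι`, `ι : Fin d × Bool`; `−ι` is `srev ι`; `e_1 = unitSite1 d`.
* Sums "`Σ_x L ≤ C Σ_x R`" of non-negative families are typed in TRANSFER FORM with `SumLE f β := Summable f ∧ ∑' f ≤ β`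
  (`NobleAssumptions`), equivalent to the printed statement and immune to the junk value of `∑'`; (4.22) is in
  addition available as the literal `∑' ≤ ∑'` because it holds termwise with equality.

## DIVERGENCES from the printed text (recorded, not silently repaired)

* (4.31), third item.  Print: `Σ_ι Ξ^{(0),ι}_{α,II,p}(e_ι) ≤ τ_{3,p}(e_1)`.  Since `Ξ^{(0),ι}_{α,II}(e_ι) = Ξ^{(0),ι}(e_ι) = τ_{3,p}(e_1)`
  for EVERY `ι` (4.49), the printed left side equals `2d·τ_{3,p}(e_1)` and the display cannot hold as printed; the
  quantity that Assumption 4.3 of the companion paper [FitznerVanDerHofstad2016NoBLE, (4.39)] asks to bound is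
  `sup_ι Σ_κ Ξ^{(0),ι}_{α,II}(e_κ)`, which equals `τ_{3,p}(e_1)` — this is `FvdH17_L43_d431c`.
* (4.32).  Print sums `Σ_ι Ξ^{(0),ι}_{α,I,p}(e_1 + e_ι)`; typed (and proved) is `Σ_κ Ξ^{(0),ι}_{α,I,p}(e_ι + e_κ)` for each `ι`,
  the [NoBLE, (4.38)] shape; the two agree by the hyperoctahedral symmetry, and the proof given is the printed one.
* (4.37): constant and argument, see "NOT typed" above.
* (4.38) is stated for fixed `ι` summed over `κ`; its printed proof (4.53) sums over `ι` for fixed `κ` and bounds the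
  full triple sum.  Both single-index forms are typed ((4.38) verbatim; (4.53) verbatim) — the NoBLE bootstrap
  consumes the per-`κ` one.
* (4.39) writes `Π^{(0),ι,κ}_{R,I,p}`; there is one remainder `Π^{(0),ι,κ}_{R,p}` ((3.66)), which is what is typed.

## How this feeds the programme

`NobleAssumption43At d p S i` (`NobleAssumptions`) for `S = percolationNobleSplit d p hd hp`: the fields
`xiIotaAlphaIAtEi`, `xiIotaAlphaIIAtZero`, `xiIotaAlphaIISumAroundZero`, `xiIotaAlphaISumAroundEi`, `piAlpha_upper` are
discharged outright by `FvdH17_L43_d431a/b/c`, `FvdH17_L43_d432`, `FvdH17_L43_piAlpha_sum_le` (given numerical majorants of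
`τ_{3,p}(e_1)`), `xiR0`/`xiR0Delta`-type fields by `FvdH17_L42_d423a/b` from bounds on `Σ 𝓓_{2,2}`, and the remaining
`N = 0` fields from the named facts of section H together with bounds on the simple diagrams (§4.2, (4.18)–(4.21),
not in this module).

Helper facts about `ℤ^d` and open paths used on the way (parity of walk length `even_length_iff_of_zdWalk`, first
edge of a walk, upper/finitary set algebra, relabelling invariance of `openConnGe`) are proved in sections A–B and
tagged `[folklore]`.
-/

noncomputable section

namespace Literature.Probability.FitznerVanDerHofstad2017

open _root_.MeasureTheory Literature.Barriers.CriticalPhenomena Literature.Probability.Percolation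
open Literature.Probability.LatticeModels
open scoped BigOperators ENNReal

local notation "𝐞" => Literature.Probability.Percolation.stepVec

/-! ### A. The event `{v ←m→ x}` and the simple diagrams `τ_{m,p}`, `𝓓_{j₁,j₂}` -/

section Events

variable {V W : Type*}

/-- **`{v ←m→ x}`** ([FvdH17] §4.2, text above (4.1), arXiv:1506.07977v2 p. 34; EJP 22 (2017) no. 43 p. 31):
"`v` is connected to `x` by a path of occupied bonds of at least `m` steps" — READ (see the module
docstring, item PATH READING) as: the open subgraph contains a *vertex-simple* path (`SimpleGraph.Walk.IsPath`)
from `v` to `x` of length `≥ m`.  For `m = 0` this is `{v ↔ x}` (`openConnGe_zero`); `{v ←m→ v} = ∅` for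
`m ≥ 1` (`openConnGe_self_eq_empty`). [cite: FitznerVanDerHofstad2017, §4.2 (4.1) (arXiv:1506.07977v2 p. 34)] -/
def openConnGe (m : ℕ) (v x : V) : Set (BondConfig V) :=
  {ω | ∃ w : (openGraph ω).Walk v x, w.IsPath ∧ m ≤ w.length}

/-- Membership in `{v ←m→ x}` (definitional). [cite: FitznerVanDerHofstad2017, §4.2 (4.1) (arXiv:1506.07977v2 p. 34)] -/
theorem mem_openConnGe_iff (m : ℕ) (v x : V) (ω : BondConfig V) :
    ω ∈ openConnGe m v x ↔ ∃ w : (openGraph ω).Walk v x, w.IsPath ∧ m ≤ w.length := Iff.rfl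

/-- The edges of an open walk lie in the open graph of any configuration containing them. [folklore] -/
theorem walk_edges_mem_edgeSet_openGraph {ω : BondConfig V} {x y : V} (w : (openGraph ω).Walk x y)
    {K : Set (Sym2 V)} (hK : ∀ e ∈ w.edges, e ∈ K) : ∀ e, e ∈ w.edges → e ∈ (openGraph K).edgeSet := by
  intro e he
  have heω : e ∈ (openGraph ω).edgeSet := w.edges_subset_edgeSet he
  change e ∈ (SimpleGraph.fromEdgeSet K).edgeSet
  rw [SimpleGraph.edgeSet_fromEdgeSet]
  exact ⟨hK e he, SimpleGraph.not_isDiag_of_mem_edgeSet _ heω⟩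

/-- A configuration containing the edges of an open simple path of length `≥ m` from `v` to `x` lies in
`{v ←m→ x}`. [folklore] -/
theorem mem_openConnGe_of_walk {ω : BondConfig V} {v x : V} (w : (openGraph ω).Walk v x) (hw : w.IsPath)
    {m : ℕ} (hm : m ≤ w.length) {K : Set (Sym2 V)} (hK : ∀ e ∈ w.edges, e ∈ K) : K ∈ openConnGe m v x :=
  ⟨w.transfer (openGraph K) (walk_edges_mem_edgeSet_openGraph w hK), hw.transfer _,
    by rwa [SimpleGraph.Walk.length_transfer]⟩

/-- `{v ←m→ x}` is decreasing in `m`. [folklore] -/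
theorem openConnGe_anti {m m' : ℕ} (h : m ≤ m') (v x : V) :
    (openConnGe m' v x : Set (BondConfig V)) ⊆ openConnGe m v x :=
  fun _ ⟨w, hw, hm⟩ => ⟨w, hw, h.trans hm⟩

/-- `{v ←m→ x}` is an increasing event. [folklore] -/
theorem isUpperSet_openConnGe (m : ℕ) (v x : V) : IsUpperSet (openConnGe m v x : Set (BondConfig V)) :=
  fun _ _ hle ⟨w, hw, hm⟩ => mem_openConnGe_of_walk w hw hm fun _ he => hle (mem_of_mem_walk_edges w he)

/-- `{v ←m→ x}` is finitary (witnessed by the finitely many edges of the path). [folklore] -/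
theorem isFinitary_openConnGe [DecidableEq V] (m : ℕ) (v x : V) :
    IsFinitary (openConnGe m v x : Set (BondConfig V)) := by
  rintro ω ⟨w, hw, hm⟩
  refine ⟨w.edges.toFinset, fun e he => mem_of_mem_walk_edges w (by simpa using he), ?_⟩
  exact mem_openConnGe_of_walk w hw hm fun e he => by simp [he]

/-- `{v ←m→ x}` is measurable (`V` countable). [folklore] -/
theorem measurableSet_openConnGe [Countable V] (m : ℕ) (v x : V) :
    MeasurableSet (openConnGe m v x : Set (BondConfig V)) := by
  classical
  exact (isFinitary_openConnGe m v x).measurableSet (isUpperSet_openConnGe m v x)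

/-- `{v ←m→ x} ⊆ {v ↔ x}`. [folklore] -/
theorem openConnGe_subset_openConn (m : ℕ) (v x : V) :
    (openConnGe m v x : Set (BondConfig V)) ⊆ openConn v x :=
  fun _ ⟨w, _, _⟩ => ⟨w⟩

/-- `{v ←0→ x} = {v ↔ x}` (every connection is witnessed by a simple path). [folklore] -/
theorem openConnGe_zero (v x : V) : (openConnGe 0 v x : Set (BondConfig V)) = openConn v x := by
  refine Set.Subset.antisymm (openConnGe_subset_openConn 0 v x) fun ω h => ?_
  obtain ⟨w, hw⟩ := SimpleGraph.Reachable.exists_isPath h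
  exact ⟨w, hw, Nat.zero_le _⟩

/-- A walk between distinct vertices has positive length. [folklore] -/
theorem one_le_length_of_ne {G : SimpleGraph V} {v x : V} (w : G.Walk v x) (h : v ≠ x) : 1 ≤ w.length :=
  Nat.one_le_iff_ne_zero.2 fun h0 => h (SimpleGraph.Walk.eq_of_length_eq_zero h0)

/-- `{v ←1→ x} = {v ↔ x}` for `v ≠ x`. [folklore] -/
theorem openConnGe_one_eq {v x : V} (hvx : v ≠ x) : (openConnGe 1 v x : Set (BondConfig V)) = openConn v x := by
  refine Set.Subset.antisymm (openConnGe_subset_openConn 1 v x) fun ω h => ?_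
  obtain ⟨w, hw⟩ := SimpleGraph.Reachable.exists_isPath h
  exact ⟨w, hw, one_le_length_of_ne w hvx⟩

/-- **`{v ←m→ v} = ∅` for `m ≥ 1`** (a simple closed path is trivial) — the fact behind
"`Ξ^{(0),ι}_{α,II}(0) = 0`" in [FvdH17] (4.31). [cite: FitznerVanDerHofstad2017, Lemma 4.3 (4.31) (arXiv:1506.07977v2 p. 37)] -/
theorem openConnGe_self_eq_empty {m : ℕ} (hm : m ≠ 0) (v : V) : (openConnGe m v v : Set (BondConfig V)) = ∅ := by
  ext ω
  simp only [Set.mem_empty_iff_false, iff_false]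
  rintro ⟨w, hw, hmw⟩
  rw [SimpleGraph.Walk.isPath_iff_nil, ← SimpleGraph.Walk.length_eq_zero_iff] at hw
  exact hm (Nat.eq_zero_of_le_zero (hw ▸ hmw))

/-- A walk of length one consists of the bond between its endpoints. [folklore] -/
theorem mk_mem_edges_of_length_eq_one {G : SimpleGraph V} :
    ∀ {u v : V} (w : G.Walk u v), w.length = 1 → s(u, v) ∈ w.edges
  | _, _, .nil, h => by simp at h
  | u, v, .cons (v := z) hadj w', h => by
    have h0 : w'.length = 0 := by
      rw [SimpleGraph.Walk.length_cons] at h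
      omega
    have hz : z = v := SimpleGraph.Walk.eq_of_length_eq_zero h0
    subst hz
    simp

/-- A non-trivial walk starts with a bond. [folklore] -/
theorem exists_eq_cons_of_ne {G : SimpleGraph V} :
    ∀ {u v : V} (w : G.Walk u v), u ≠ v → ∃ (a : V) (h : G.Adj u a) (q : G.Walk a v), w = .cons h q
  | _, _, .nil, h => absurd rfl h
  | _, _, .cons hadj q, _ => ⟨_, hadj, q, rfl⟩

/-- A simple path between DISTINCT endpoints `u ≠ v` which is not the single bond `(u,v)` does not use that
bond (its endpoints occur only once on it). [folklore] -/
theorem mk_not_mem_edges_of_isPath {G : SimpleGraph V} {u v : V} (huv : u ≠ v) (w : G.Walk u v)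
    (hw : w.IsPath) (h1 : w.length ≠ 1) : s(u, v) ∉ w.edges := by
  intro hmem
  obtain ⟨a, b, q₁, hab, q₂, he, hw'⟩ := LaceGraph.exists_append_cons_of_mem_edges w hmem
  rcases Sym2.eq_iff.1 he with ⟨hua, hvb⟩ | ⟨hub, hva⟩
  · subst hua hvb
    rw [hw'] at hw h1
    have hq₁ : q₁.length = 0 :=
      SimpleGraph.Walk.length_eq_zero_iff.2 (SimpleGraph.Walk.isPath_iff_nil.1 hw.of_append_left)
    have hq₂ : q₂.length = 0 := SimpleGraph.Walk.length_eq_zero_iff.2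
      (SimpleGraph.Walk.isPath_iff_nil.1 ((SimpleGraph.Walk.cons_isPath_iff _ _).1 hw.of_append_right).1)
    simp only [SimpleGraph.Walk.length_append, SimpleGraph.Walk.length_cons, hq₁, hq₂] at h1
    exact h1 rfl
  · subst hub hva
    rw [hw'] at hw
    obtain ⟨-, -, hmeet⟩ := LaceGraph.isPath_of_append hw
    exact huv (hmeet u q₁.start_mem_support (by simp))

/-- Transport of `{v ←m→ x}` under a relabelling of the vertex set. [folklore] -/
theorem relabel_mem_openConnGe (φ : V ≃ W) {ω : BondConfig V} {m : ℕ} {v x : V} (h : ω ∈ openConnGe m v x) :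
    BondConfig.relabel (sym2Equiv φ) ω ∈ openConnGe m (φ v) (φ x) := by
  obtain ⟨w, hw, hm⟩ := h
  let f : openGraph ω →g openGraph (BondConfig.relabel (sym2Equiv φ) ω) :=
    (Literature.Barriers.CriticalPhenomena.openGraphRelabelIso φ ω : openGraph ω ≃g _)
  have hf : Function.Injective f := φ.injective
  refine ⟨w.map f, (SimpleGraph.Walk.isPath_map_iff_of_injective hf).2 hw, ?_⟩
  have hlen : (w.map f).length = w.length := SimpleGraph.Walk.length_map f w
  exact hm.trans_eq hlen.symm

/-- Transport of `{v ←m→ x}` under a relabelling of the vertex set (both directions). [folklore] -/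
theorem relabel_mem_openConnGe_iff (φ : V ≃ W) (ω : BondConfig V) (m : ℕ) (v x : V) :
    BondConfig.relabel (sym2Equiv φ) ω ∈ openConnGe m (φ v) (φ x) ↔ ω ∈ openConnGe m v x := by
  refine ⟨fun h => ?_, relabel_mem_openConnGe φ⟩
  have h' := relabel_mem_openConnGe φ.symm h
  simpa only [relabel_symm_relabel, Equiv.symm_apply_apply] using h'

/-- Two EDGE-DISJOINT open simple paths from `v` to `x` of lengths `≥ m₁`, `≥ m₂` witness the disjoint
occurrence `{v ←m₁→ x} ∘ {v ←m₂→ x}`. [cite: FitznerVanDerHofstad2017, §4.2 (4.12) (arXiv:1506.07977v2 p. 35)] -/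
theorem mem_disjointOccurrence_openConnGe_of_paths {ω : BondConfig V} {v x : V}
    (P Q : (openGraph ω).Walk v x) (hP : P.IsPath) (hQ : Q.IsPath) (hPQ : List.Disjoint P.edges Q.edges)
    {m₁ m₂ : ℕ} (h₁ : m₁ ≤ P.length) (h₂ : m₂ ≤ Q.length) :
    ω ∈ openConnGe m₁ v x □ openConnGe m₂ v x := by
  rw [(isUpperSet_openConnGe m₁ v x).mem_disjointOccurrence_iff (isUpperSet_openConnGe m₂ v x)]
  refine ⟨{e | e ∈ P.edges}, fun e he => mem_of_mem_walk_edges P he, {e | e ∈ Q.edges},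
    fun e he => mem_of_mem_walk_edges Q he, ?_, ?_, ?_⟩
  · exact Set.disjoint_left.2 fun e heP heQ => hPQ heP heQ
  · exact mem_openConnGe_of_walk P hP h₁ fun e he => he
  · exact mem_openConnGe_of_walk Q hQ h₂ fun e he => he

/-- `{ω ∖ B ∈ A}` is increasing for increasing `A`. [folklore] -/
theorem isUpperSet_sdiff_mem {A : Set (BondConfig V)} (hA : IsUpperSet A) (B : Set (Sym2 V)) :
    IsUpperSet {ω : BondConfig V | ω \ B ∈ A} :=
  fun _ _ h hω => hA (Set.sdiff_subset_sdiff_left h) hω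

/-- `{ω ∖ B ∈ A}` is finitary for finitary `A`. [folklore] -/
theorem isFinitary_sdiff_mem {A : Set (BondConfig V)} (hAf : IsFinitary A) (B : Set (Sym2 V)) :
    IsFinitary {ω : BondConfig V | ω \ B ∈ A} := by
  intro ω hω
  obtain ⟨K, hK, hKA⟩ := hAf _ hω
  refine ⟨K, fun f hf => (hK hf).1, ?_⟩
  show (↑K : Set (Sym2 V)) \ B ∈ A
  rwa [sdiff_eq_left.2 (Set.disjoint_left.2 fun f hfK hfB => (hK hfK).2 hfB)]

/-- The one-bond cylinder `{f ∈ ω}` is increasing. [folklore] -/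
theorem isUpperSet_mem_bond (f : Sym2 V) : IsUpperSet {ω : BondConfig V | f ∈ ω} := fun _ _ h hf => h hf

/-- The one-bond cylinder `{f ∈ ω}` is finitary. [folklore] -/
theorem isFinitary_mem_bond (f : Sym2 V) : IsFinitary {ω : BondConfig V | f ∈ ω} :=
  fun _ hω => ⟨{f}, by simpa using hω, by simp⟩

end Events

section Lattice

variable {d : ℕ}

/-- **`τ_{m,p}(x) = P_p(0 ←m→ x)`** ([FvdH17] (4.1), arXiv:1506.07977v2 p. 34; EJP p. 31), under the PATH
READING of `{0 ←m→ x}` (`openConnGe`). [cite: FitznerVanDerHofstad2017, §4.2 (4.1) (arXiv:1506.07977v2 p. 34)] -/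
def tauGe (d : ℕ) (p : unitInterval) (m : ℕ) (x : Site d) : ℝ :=
  (bondPercolation (zdGraph d) p).real (openConnGe m 0 x)

/-- **`𝓓_{j₁,j₂}(x) = P_p({0 ←j₁→ x} ∘ {0 ←j₂→ x})`** ([FvdH17] (4.12), arXiv:1506.07977v2 p. 35; EJP p. 32)
with two LOWER indices only (no upper `l₁,l₂` constraint — the only instances used in Lemmas 4.2/4.3),
`[0,∞]`-valued. [cite: FitznerVanDerHofstad2017, §4.2 (4.12) (arXiv:1506.07977v2 p. 35)] -/
def diagDT (d : ℕ) (p : unitInterval) (j₁ j₂ : ℕ) (x : Site d) : ℝ≥0∞ :=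
  bondPercolation (zdGraph d) p (openConnGe j₁ 0 x □ openConnGe j₂ 0 x)

/-- **`𝓓_{j₁,j₂}(x)`** ([FvdH17] (4.12)), real-valued. [cite: FitznerVanDerHofstad2017, §4.2 (4.12) (arXiv:1506.07977v2 p. 35)] -/
def diagD (d : ℕ) (p : unitInterval) (j₁ j₂ : ℕ) (x : Site d) : ℝ := (diagDT d p j₁ j₂ x).toReal

/-- `0 ≤ τ_{m,p}(x)`. [folklore] -/
theorem tauGe_nonneg (p : unitInterval) (m : ℕ) (x : Site d) : 0 ≤ tauGe d p m x := measureReal_nonneg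

/-- `0 ≤ 𝓓_{j₁,j₂}(x)`. [folklore] -/
theorem diagD_nonneg (p : unitInterval) (j₁ j₂ : ℕ) (x : Site d) : 0 ≤ diagD d p j₁ j₂ x := ENNReal.toReal_nonneg

/-- `𝓓_{j₁,j₂}(x) < ∞` (a probability). [folklore] -/
theorem diagDT_ne_top (p : unitInterval) (j₁ j₂ : ℕ) (x : Site d) : diagDT d p j₁ j₂ x ≠ ∞ := measure_ne_top _ _

/-- `τ_{m,p}(x) ≤ 1`. [folklore] -/
theorem tauGe_le_one (p : unitInterval) (m : ℕ) (x : Site d) : tauGe d p m x ≤ 1 := by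
  unfold tauGe
  exact (measureReal_mono (Set.subset_univ _)).trans_eq (by simp)

/-- `τ_{m,p}(0) = 0` for `m ≥ 1`. [cite: FitznerVanDerHofstad2017, §4.2 (4.1) (arXiv:1506.07977v2 p. 34)] -/
theorem tauGe_zero_of_ne (p : unitInterval) {m : ℕ} (hm : m ≠ 0) : tauGe d p m 0 = 0 := by
  simp [tauGe, openConnGe_self_eq_empty hm]

/-- `𝓓_{j₁,j₂}(0) = 0` when `j₁ ≥ 1`. [cite: FitznerVanDerHofstad2017, §4.2 (4.12) (arXiv:1506.07977v2 p. 35)] -/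
theorem diagDT_zero_of_ne (p : unitInterval) {j₁ : ℕ} (hj : j₁ ≠ 0) (j₂ : ℕ) : diagDT d p j₁ j₂ 0 = 0 := by
  refine measure_mono_null (disjointOccurrence_subset_inter _ _) ?_
  rw [openConnGe_self_eq_empty hj, Set.empty_inter]
  exact measure_empty

/-- `𝓓_{j₁,j₂} = 𝓓_{j₂,j₁}`. [cite: FitznerVanDerHofstad2017, §4.2 (4.12) (arXiv:1506.07977v2 p. 35)] -/
theorem diagDT_comm (p : unitInterval) (j₁ j₂ : ℕ) (x : Site d) : diagDT d p j₁ j₂ x = diagDT d p j₂ j₁ x := by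
  unfold diagDT
  rw [disjointOccurrence_comm]

/-- `𝓓_{j₁,j₂}` is decreasing in its indices. [cite: FitznerVanDerHofstad2017, §4.2 (4.12) (arXiv:1506.07977v2 p. 35)] -/
theorem diagDT_anti (p : unitInterval) {j₁ j₁' j₂ j₂' : ℕ} (h₁ : j₁ ≤ j₁') (h₂ : j₂ ≤ j₂') (x : Site d) :
    diagDT d p j₁' j₂' x ≤ diagDT d p j₁ j₂ x :=
  measure_mono (disjointOccurrence_mono (openConnGe_anti h₁ 0 x) (openConnGe_anti h₂ 0 x))

/-- **BK for the simple diagram: `𝓓_{j₁,j₂}(x) ≤ τ_{j₁,p}(x) τ_{j₂,p}(x)`** (both events increasing and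
finitary; van den Berg–Kesten). [cite: FitznerVanDerHofstad2017, §4.2 (4.12) (arXiv:1506.07977v2 p. 35)] -/
theorem diagD_le_tauGe_mul (p : unitInterval) (j₁ j₂ : ℕ) (x : Site d) :
    diagD d p j₁ j₂ x ≤ tauGe d p j₁ x * tauGe d p j₂ x := by
  classical
  exact bk_finitary (zdGraph d) p (isUpperSet_openConnGe j₁ 0 x) (isUpperSet_openConnGe j₂ 0 x)
    (isFinitary_openConnGe j₁ 0 x) (isFinitary_openConnGe j₂ 0 x)

/-- Transport of `P_p(v ←m→ x)` under a lattice automorphism. [folklore] -/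
theorem measure_openConnGe_iso (φ : zdGraph d ≃g zdGraph d) (p : unitInterval) (m : ℕ) (v x : Site d) :
    bondPercolation (zdGraph d) p (openConnGe m (φ v) (φ x)) = bondPercolation (zdGraph d) p (openConnGe m v x) := by
  have h := measure_setOf_relabel φ p (P := fun ζ => ζ ∈ openConnGe m v x)
    (P' := fun ζ => ζ ∈ openConnGe m (φ v) (φ x)) (fun ζ => relabel_mem_openConnGe_iff φ.toEquiv ζ m v x)
  simpa only [Set.setOf_mem_eq] using h

/-- `τ_{m,p}(φ x) = τ_{m,p}(x)` for a lattice automorphism fixing the origin. [folklore] -/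
theorem tauGe_iso (φ : zdGraph d ≃g zdGraph d) (hφ : φ 0 = 0) (p : unitInterval) (m : ℕ) (x : Site d) :
    tauGe d p m (φ x) = tauGe d p m x := by
  unfold tauGe
  have h := measure_openConnGe_iso φ p m 0 x
  rw [hφ] at h
  simp only [measureReal_def, h]

/-- `P_p(v ←m→ x) = τ_{m,p}(x - v)` (translation invariance). [folklore] -/
theorem measureReal_openConnGe_eq_tauGe (p : unitInterval) (m : ℕ) (v x : Site d) :
    (bondPercolation (zdGraph d) p).real (openConnGe m v x) = tauGe d p m (x - v) := by
  unfold tauGe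
  have h := measure_openConnGe_iso (zdShiftIso (-v)) p m v x
  simp only [zdShiftIso_apply, add_neg_cancel, ← sub_eq_add_neg] at h
  simp only [measureReal_def, h]

/-- **`τ_{m,p}(e_ι) = τ_{m,p}(e₁)`** for every one of the `2d` unit steps `e_ι` (signed-permutation
symmetry); `e₁ = unitSite1 d`. [cite: FitznerVanDerHofstad2017, §4.2 (4.1) (arXiv:1506.07977v2 p. 34)] -/
theorem tauGe_stepVec (hd : 1 ≤ d) (p : unitInterval) (m : ℕ) (ι : Fin d × Bool) :
    tauGe d p m (𝐞 ι) = tauGe d p m (unitSite1 d) := by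
  have he1 : unitSite1 d = 𝐞 ((⟨0, hd⟩ : Fin d), true) := by
    rw [unitSite1_eq_single hd, stepVec_eq_single]
    simp
  obtain ⟨π, ε, hπ⟩ := exists_signedPerm_stepVec ((⟨0, hd⟩ : Fin d), true) ι
  rw [he1, ← hπ]
  have h := tauGe_iso (zdSignedPermIso π ε) (by simp) p m (𝐞 ((⟨0, hd⟩ : Fin d), true))
  simpa only [zdSignedPermIso_apply] using h

/-! ### B. Chessboard parity and the bond `(0, e)` -/

/-- Parity of a nearest-neighbour lattice walk: its length is even iff its endpoints have the same
chessboard colour. [folklore] -/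
theorem even_length_iff_of_zdWalk : ∀ {x y : Site d} (w : (zdGraph d).Walk x y),
    (Even w.length ↔ (Even (∑ i, x i) ↔ Even (∑ i, y i)))
  | _, _, .nil => by simp
  | x, y, .cons (v := z) h w => by
    have ih := even_length_iff_of_zdWalk w
    have hxz := zdGraph_adj_even_sum_iff h
    rw [SimpleGraph.Walk.length_cons, Nat.even_add_one, ih]
    tauto

/-- An open walk (in a configuration of lattice bonds) between the endpoints of a lattice bond has ODD
length. [folklore] -/
theorem not_even_length_of_adj {ω : BondConfig (Site d)} (hω : ω ⊆ (zdGraph d).edgeSet) {a b : Site d}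
    (hab : (zdGraph d).Adj a b) (w : (openGraph ω).Walk a b) : ¬ Even w.length := by
  have h := even_length_iff_of_zdWalk (w.transfer (zdGraph d) fun e he => hω (mem_of_mem_walk_edges w he))
  rw [SimpleGraph.Walk.length_transfer] at h
  have h1 := zdGraph_adj_even_sum_iff hab
  tauto

/-- An open walk between the endpoints of a lattice bond `(a,b)` which avoids that bond has length `≥ 3`.
[cite: FitznerVanDerHofstad2017, Lemma 4.3 proof, (4.49) (arXiv:1506.07977v2 p. 40)] -/
theorem three_le_length_of_not_mem {ω : BondConfig (Site d)} (hω : ω ⊆ (zdGraph d).edgeSet) {a b : Site d}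
    (hab : (zdGraph d).Adj a b) (w : (openGraph ω).Walk a b) (hb : s(a, b) ∉ w.edges) : 3 ≤ w.length := by
  have hodd := not_even_length_of_adj hω hab w
  have h1 : w.length ≠ 1 := fun h => hb (mk_mem_edges_of_length_eq_one w h)
  rcases Nat.even_or_odd w.length with he | ⟨k, hk⟩
  · exact absurd he hodd
  · omega

/-- `{a ←3→ b} ⊆ {a ↔ b off the bond (a,b)}` for `a ≠ b`: a simple path of length `≥ 3` does not use the
bond between its endpoints. [cite: FitznerVanDerHofstad2017, Lemma 4.3 proof, (4.49) (arXiv:1506.07977v2 p. 40)] -/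
theorem openConnGe_three_subset_sdiff_mem_openConn {a b : Site d} (hab : a ≠ b) :
    (openConnGe 3 a b : Set (BondConfig (Site d))) ⊆ {ω | ω \ {s(a, b)} ∈ (openConn a b : Set _)} := by
  rintro ω ⟨w, hw, hm⟩
  exact reachable_sdiff_of_walk w (mk_not_mem_edges_of_isPath hab w hw (by omega))

/-- `{a ↔ b off (a,b)} ⊆ {a ←3→ b}` on configurations of lattice bonds, for a lattice bond `(a,b)` (parity).
[cite: FitznerVanDerHofstad2017, Lemma 4.3 proof, (4.49) (arXiv:1506.07977v2 p. 40)] -/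
theorem mem_openConnGe_three_of_sdiff {ω : BondConfig (Site d)} (hω : ω ⊆ (zdGraph d).edgeSet) {a b : Site d}
    (hab : (zdGraph d).Adj a b) (h : ω \ {s(a, b)} ∈ (openConn a b : Set (BondConfig (Site d)))) :
    ω ∈ openConnGe 3 a b := by
  obtain ⟨w, hw⟩ := SimpleGraph.Reachable.exists_isPath h
  have hω' : ω \ {s(a, b)} ⊆ (zdGraph d).edgeSet := Set.sdiff_subset.trans hω
  have hb : s(a, b) ∉ w.edges := fun he => (mem_of_mem_walk_edges w he).2 rfl
  have h3 := three_le_length_of_not_mem hω' hab w hb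
  exact isUpperSet_openConnGe 3 a b Set.sdiff_subset (show ω \ {s(a, b)} ∈ openConnGe 3 a b from ⟨w, hw, h3⟩)

/-- **`P_p(a ↔ b off the bond (a,b)) = P_p(a ←3→ b)`** for a lattice bond `(a,b)` — the identity behind
`Ξ^{(0),ι}(e_ι) = τ_{3,p}(e_ι)` ([FvdH17] (4.49)). [cite: FitznerVanDerHofstad2017, Lemma 4.3 proof, (4.49) (arXiv:1506.07977v2 p. 40)] -/
theorem measure_sdiff_mem_openConn_eq {a b : Site d} (hab : (zdGraph d).Adj a b) (p : unitInterval) :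
    bondPercolation (zdGraph d) p {ω | ω \ {s(a, b)} ∈ (openConn a b : Set (BondConfig (Site d)))} =
      bondPercolation (zdGraph d) p (openConnGe 3 a b) := by
  refine le_antisymm ?_ (measure_mono (openConnGe_three_subset_sdiff_mem_openConn hab.ne))
  calc bondPercolation (zdGraph d) p {ω | ω \ {s(a, b)} ∈ (openConn a b : Set (BondConfig (Site d)))}
      ≤ bondPercolation (zdGraph d) p (openConnGe 3 a b ∪ {ω | ¬ ω ⊆ (zdGraph d).edgeSet}) :=
        measure_mono fun ω hω => by
          by_cases hE : ω ⊆ (zdGraph d).edgeSet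
          · exact Or.inl (mem_openConnGe_three_of_sdiff hE hab hω)
          · exact Or.inr hE
    _ ≤ bondPercolation (zdGraph d) p (openConnGe 3 a b) +
          bondPercolation (zdGraph d) p {ω | ¬ ω ⊆ (zdGraph d).edgeSet} := measure_union_le _ _
    _ = bondPercolation (zdGraph d) p (openConnGe 3 a b) := by rw [measure_not_subset_edgeSet, add_zero]

/-- `P_p(a ↔ b off (a,b)) = P_p(a ←3→ b)` in `probOff` form. [cite: FitznerVanDerHofstad2017, Lemma 4.3 proof, (4.49) (arXiv:1506.07977v2 p. 40)] -/
theorem probOff_singleton_openConn_eq {a b : Site d} (hab : (zdGraph d).Adj a b) (p : unitInterval) :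
    probOff d p {s(a, b)} (openConn a b) = bondPercolation (zdGraph d) p (openConnGe 3 a b) :=
  measure_sdiff_mem_openConn_eq hab p

/-! ### C. `Ξ^{(0)}(x) = 𝓓_{1,1}(x)` and (4.22) -/

/-- `{v ↔ x through {v}} = {v ↔ x}`: a connection event constrained to pass through its own starting point.
[cite: FitznerVanDerHofstad2017, Definition 3.1 (connection through A) (arXiv:1506.07977v2 p. 21)] -/
theorem connThrough_singleton_start (v x : Site d) : connThrough {v} v x = openConn v x := by
  ext ω
  rw [mem_connThrough_iff]
  constructor
  · exact fun h => h.1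
  · intro h
    refine ⟨h, ?_⟩
    rintro ⟨hv, -, -⟩
    exact hv rfl

/-- **`E'(v,x;{v}) = E'(v,x;ℤ^d)`**: for `N = 0` the NoBLE event `E'(0,x;{0})` of `Ξ^{(0)}(x)` is the classical
lace-expansion event "`0 ⇔ x` with no pivotal bond". [cite: FitznerVanDerHofstad2017, Lemma 4.2 proof, (4.40) (arXiv:1506.07977v2 p. 38)] -/
theorem laceE_singleton_start_eq_univ (v x : Site d) : laceE {v} v x = laceE Set.univ v x := by
  ext ω
  simp only [mem_laceE_iff, connThrough_singleton_start, connThrough_univ]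

/-- From `ω ∈ E'(v,x;ℤ^d)` (no pivotal bond for `v → x`) on lattice bonds: two EDGE-DISJOINT open simple
paths `v → x` (Menger, `k = 2`). [cite: FitznerVanDerHofstad2017, Lemma 4.2 proof, (4.40) (arXiv:1506.07977v2 p. 38)] -/
theorem exists_two_paths_of_mem_laceE_univ {ω : BondConfig (Site d)} (hω : ω ⊆ (zdGraph d).edgeSet)
    {v x : Site d} (hE : ω ∈ laceE Set.univ v x) :
    ∃ P Q : (openGraph ω).Walk v x, P.IsPath ∧ Q.IsPath ∧ List.Disjoint P.edges Q.edges := by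
  classical
  obtain ⟨hconn, hpiv⟩ := (mem_laceE_iff Set.univ v x ω).1 hE
  rw [connThrough_univ] at hconn
  obtain ⟨p, hp⟩ := (show (openGraph ω).Reachable v x from hconn).exists_isPath
  have key : ∀ e ∈ p.edges, (openGraph (ω \ {e})).Reachable v x := by
    intro e he
    by_contra h0u
    obtain ⟨a, b, q₁, hab, q₂, rfl, hq⟩ := LaceGraph.exists_append_cons_of_mem_edges p he
    have hP := isPivotalBond_of_not_reachable hω q₁ hab q₂ (hq ▸ hp) h0u
    have h0a : ω ∉ connThrough Set.univ v a := hpiv a b hP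
    rw [connThrough_univ] at h0a
    exact h0a ⟨q₁⟩
  exact LaceGraph.exists_two_edgeDisjoint_paths p.reverse hp.reverse fun e he => by
    rw [SimpleGraph.Walk.edges_reverse, List.mem_reverse] at he
    exact exists_walk_of_reachable_sdiff (key e he)

/-- `E'(v,x;ℤ^d) ⊆ {v ←1→ x} ∘ {v ←1→ x}` on lattice-bond configurations, `v ≠ x`.
[cite: FitznerVanDerHofstad2017, Lemma 4.2 proof, (4.40) (arXiv:1506.07977v2 p. 38)] -/
theorem mem_diag11_of_mem_laceE_univ {ω : BondConfig (Site d)} (hω : ω ⊆ (zdGraph d).edgeSet)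
    {v x : Site d} (hvx : v ≠ x) (hE : ω ∈ laceE Set.univ v x) :
    ω ∈ openConnGe 1 v x □ openConnGe 1 v x := by
  obtain ⟨P, Q, hP, hQ, hPQ⟩ := exists_two_paths_of_mem_laceE_univ hω hE
  exact mem_disjointOccurrence_openConnGe_of_paths P Q hP hQ hPQ (one_le_length_of_ne P hvx)
    (one_le_length_of_ne Q hvx)

/-- `E'(v,x;ℤ^d) ∩ {(v,x) vacant} ⊆ {v ←2→ x} ∘ {v ←2→ x}` on lattice-bond configurations, `v ≠ x` — the
event inclusion behind (4.23). [cite: FitznerVanDerHofstad2017, Lemma 4.2 proof, (4.40) (arXiv:1506.07977v2 p. 38)] -/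
theorem mem_diag22_of_mem_laceE_univ {ω : BondConfig (Site d)} (hω : ω ⊆ (zdGraph d).edgeSet)
    {v x : Site d} (hvx : v ≠ x) (hE : ω ∈ laceE Set.univ v x) (hb : s(v, x) ∉ ω) :
    ω ∈ openConnGe 2 v x □ openConnGe 2 v x := by
  obtain ⟨P, Q, hP, hQ, hPQ⟩ := exists_two_paths_of_mem_laceE_univ hω hE
  have h2 : ∀ R : (openGraph ω).Walk v x, 2 ≤ R.length := fun R => by
    have h0 := one_le_length_of_ne R hvx
    have h1 : R.length ≠ 1 := fun h => hb (mem_of_mem_walk_edges R (mk_mem_edges_of_length_eq_one R h))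
    omega
  exact mem_disjointOccurrence_openConnGe_of_paths P Q hP hQ hPQ (h2 P) (h2 Q)

/-- `{v ←m₁→ x} ∘ {v ←m₂→ x} ⊆ E'(v,x;ℤ^d)`: two bond-disjointly occurring connections leave no pivotal
bond. [cite: FitznerVanDerHofstad2017, Lemma 4.2 proof, (4.40) (arXiv:1506.07977v2 p. 38)] -/
theorem disjointOccurrence_openConnGe_subset_laceE (m₁ m₂ : ℕ) (v x : Site d) :
    openConnGe m₁ v x □ openConnGe m₂ v x ⊆ laceE Set.univ v x := by
  intro ω hω
  rw [(isUpperSet_openConnGe m₁ v x).mem_disjointOccurrence_iff (isUpperSet_openConnGe m₂ v x)] at hω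
  obtain ⟨K, hK, L, hL, hKL, ⟨P, -, -⟩, ⟨Q, -, -⟩⟩ := hω
  rw [mem_laceE_iff, connThrough_univ]
  refine ⟨SimpleGraph.Reachable.mono (openGraph_mono hK) ⟨P⟩, fun a b hpiv _ => ?_⟩
  obtain ⟨-, -, -, hxC, -⟩ := hpiv
  apply hxC
  rw [mem_restrCluster_iff]
  by_cases haK : s(a, b) ∈ K
  · have haL : s(a, b) ∉ L := fun h => Set.disjoint_left.1 hKL haK h
    exact SimpleGraph.Reachable.mono
      (openGraph_mono fun e he => ⟨hL he, fun h => haL ((Set.mem_singleton_iff.1 h) ▸ he)⟩) ⟨Q⟩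
  · exact SimpleGraph.Reachable.mono
      (openGraph_mono fun e he => ⟨hK he, fun h => haK ((Set.mem_singleton_iff.1 h) ▸ he)⟩) ⟨P⟩

/-- **`P_p(E'(v,x;ℤ^d)) = P_p({v ←1→ x} ∘ {v ←1→ x})`** for `v ≠ x`.
[cite: FitznerVanDerHofstad2017, Lemma 4.2 proof, (4.40) (arXiv:1506.07977v2 p. 38)] -/
theorem measure_laceE_univ_eq_diag11 (p : unitInterval) {v x : Site d} (hvx : v ≠ x) :
    bondPercolation (zdGraph d) p (laceE Set.univ v x) =
      bondPercolation (zdGraph d) p (openConnGe 1 v x □ openConnGe 1 v x) := by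
  refine le_antisymm ?_ (measure_mono (disjointOccurrence_openConnGe_subset_laceE 1 1 v x))
  calc bondPercolation (zdGraph d) p (laceE Set.univ v x)
      ≤ bondPercolation (zdGraph d) p
          ((openConnGe 1 v x □ openConnGe 1 v x) ∪ {ω | ¬ ω ⊆ (zdGraph d).edgeSet}) :=
        measure_mono fun ω hω => by
          by_cases hE : ω ⊆ (zdGraph d).edgeSet
          · exact Or.inl (mem_diag11_of_mem_laceE_univ hE hvx hω)
          · exact Or.inr hE
    _ ≤ _ := measure_union_le _ _
    _ = _ := by rw [measure_not_subset_edgeSet, add_zero]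

/-- **`Ξ^{(0)}_p(x) = 𝓓_{1,1}(x)` for every `x`** (both vanish at `x = 0`): for `N = 0` the NoBLE
coefficient IS the double-connection function ([FvdH17] (4.40) with the classical BK step not yet applied).
[cite: FitznerVanDerHofstad2017, Lemma 4.2 (4.22) (arXiv:1506.07977v2 p. 37; EJP 22 (2017) no. 43 p. 34)] -/
theorem nobleXiT_zero_eq_diagDT (p : unitInterval) (x : Site d) : nobleXiT d p 0 x = diagDT d p 1 1 x := by
  by_cases hx : x = 0
  · subst hx
    rw [nobleXiT_zero_zero, diagDT_zero_of_ne p one_ne_zero]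
  · rw [nobleXiT_zero_of_ne p hx, laceE_singleton_start_eq_univ]
    exact measure_laceE_univ_eq_diag11 p (Ne.symm hx)

/-- **`Ξ^{(0)}_p(x) = 𝓓_{1,1}(x)`**, real-valued. [cite: FitznerVanDerHofstad2017, Lemma 4.2 (4.22) (arXiv:1506.07977v2 p. 37; EJP 22 (2017) no. 43 p. 34)] -/
theorem nobleXiN_zero_eq_diagD (p : unitInterval) (x : Site d) : nobleXiN d p 0 x = diagD d p 1 1 x := by
  rw [nobleXiN_def, nobleXiT_zero_eq_diagDT]
  rfl

/-- **[FvdH17, Lemma 4.2, (4.22), first display]** `Σ_x Ξ^{(0)}_p(x) ≤ Σ_x 𝓓_{1,1}(x)` — here with EQUALITY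
of the summands, hence of the (possibly divergent, `tsum`-valued) sums, so no summability hypothesis is
needed. [cite: FitznerVanDerHofstad2017, Lemma 4.2 (4.22) (arXiv:1506.07977v2 p. 37; EJP 22 (2017) no. 43 p. 34)] -/
theorem FvdH17_L42_d422a (p : unitInterval) :
    ∑' x : Site d, nobleXiN d p 0 x ≤ ∑' x : Site d, diagD d p 1 1 x :=
  le_of_eq (tsum_congr fun x => nobleXiN_zero_eq_diagD p x)

/-- **[FvdH17, Lemma 4.2, (4.22), second display]** `Σ_x ‖x‖₂² Ξ^{(0)}_p(x) ≤ Σ_x ‖x‖₂² 𝓓_{1,1}(x)` (termwise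
equality). [cite: FitznerVanDerHofstad2017, Lemma 4.2 (4.22) (arXiv:1506.07977v2 p. 37; EJP 22 (2017) no. 43 p. 34)] -/
theorem FvdH17_L42_d422b (p : unitInterval) :
    ∑' x : Site d, euclidNorm x ^ 2 * nobleXiN d p 0 x ≤ ∑' x : Site d, euclidNorm x ^ 2 * diagD d p 1 1 x :=
  le_of_eq (tsum_congr fun x => by rw [nobleXiN_zero_eq_diagD p x])

/-- `SumLE`-transfer of (4.22): a bound `Σ_x 𝓓_{1,1}(x) ≤ β` is a bound `Σ_x Ξ^{(0)}(x) ≤ β`.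
[cite: FitznerVanDerHofstad2017, Lemma 4.2 (4.22) (arXiv:1506.07977v2 p. 37)] -/
theorem sumLE_nobleXiN_zero_of_diagD (p : unitInterval) {β : ℝ} (h : SumLE (diagD d p 1 1) β) :
    SumLE (nobleXiN d p 0) β := by
  have he : nobleXiN d p 0 = diagD d p 1 1 := funext (nobleXiN_zero_eq_diagD p)
  rwa [he]

/-- Weighted `SumLE`-transfer of (4.22). [cite: FitznerVanDerHofstad2017, Lemma 4.2 (4.22) (arXiv:1506.07977v2 p. 37)] -/
theorem sumLE_nobleXiN_zero_weighted_of_diagD (p : unitInterval) {β : ℝ}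
    (h : SumLE (fun x => euclidNorm x ^ 2 * diagD d p 1 1 x) β) :
    SumLE (fun x => euclidNorm x ^ 2 * nobleXiN d p 0 x) β := by
  have he : (fun x => euclidNorm x ^ 2 * nobleXiN d p 0 x) = fun x => euclidNorm x ^ 2 * diagD d p 1 1 x :=
    funext fun x => by rw [nobleXiN_zero_eq_diagD p x]
  rwa [he]

/-! ### D. `Ξ^{(0)}_R ≤ 𝓓_{2,2}` pointwise and (4.23) -/

/-- **`Ξ^{(0)}_p(x) ≤ Ξ^{(0)}_{α,p}(x) + 𝓓_{2,2}(x)`** ([FvdH17] (4.40) and the sentence after it: if the bond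
`(0,x)` is vacant, both bond-disjoint connections have length `≥ 2`). [cite: FitznerVanDerHofstad2017, Lemma 4.2 proof, (4.40) (arXiv:1506.07977v2 p. 38; EJP 22 (2017) no. 43 p. 35)] -/
theorem nobleXiT_zero_le_alpha_add_diagDT (p : unitInterval) (x : Site d) :
    nobleXiT d p 0 x ≤ nobleXiA0T d p x + diagDT d p 2 2 x := by
  by_cases hx : x = 0
  · subst hx
    rw [nobleXiT_zero_zero]
    exact zero_le
  have h0x : (0 : Site d) ≠ x := Ne.symm hx
  rw [nobleXiT_zero_of_ne p hx, laceE_singleton_start_eq_univ]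
  by_cases hadj : (zdGraph d).Adj 0 x
  · have hA : nobleXiA0T d p x =
        bondPercolation (zdGraph d) p {ω | ω ∈ laceE Set.univ 0 x ∧ s(0, x) ∈ ω} := by
      rw [nobleXiA0T, if_pos hadj, laceE_singleton_start_eq_univ]
    rw [hA]
    calc bondPercolation (zdGraph d) p (laceE Set.univ 0 x)
        ≤ bondPercolation (zdGraph d) p ({ω | ω ∈ laceE Set.univ 0 x ∧ s(0, x) ∈ ω} ∪
            ((openConnGe 2 0 x □ openConnGe 2 0 x) ∪ {ω | ¬ ω ⊆ (zdGraph d).edgeSet})) :=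
          measure_mono fun ω hω => by
            by_cases hb : s(0, x) ∈ ω
            · exact Or.inl ⟨hω, hb⟩
            · by_cases hE : ω ⊆ (zdGraph d).edgeSet
              · exact Or.inr (Or.inl (mem_diag22_of_mem_laceE_univ hE h0x hω hb))
              · exact Or.inr (Or.inr hE)
      _ ≤ bondPercolation (zdGraph d) p {ω | ω ∈ laceE Set.univ 0 x ∧ s(0, x) ∈ ω} +
            (bondPercolation (zdGraph d) p (openConnGe 2 0 x □ openConnGe 2 0 x) +
              bondPercolation (zdGraph d) p {ω | ¬ ω ⊆ (zdGraph d).edgeSet}) :=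
          (measure_union_le _ _).trans (add_le_add le_rfl (measure_union_le _ _))
      _ = _ := by rw [measure_not_subset_edgeSet, add_zero]; rfl
  · have hA : nobleXiA0T d p x = 0 := by rw [nobleXiA0T, if_neg hadj]
    rw [hA, zero_add]
    calc bondPercolation (zdGraph d) p (laceE Set.univ 0 x)
        ≤ bondPercolation (zdGraph d) p
            ((openConnGe 2 0 x □ openConnGe 2 0 x) ∪ {ω | ¬ ω ⊆ (zdGraph d).edgeSet}) :=
          measure_mono fun ω hω => by
            by_cases hE : ω ⊆ (zdGraph d).edgeSet
            · exact Or.inl (mem_diag22_of_mem_laceE_univ hE h0x hω fun hb => hadj (hE hb))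
            · exact Or.inr hE
      _ ≤ _ := measure_union_le _ _
      _ = _ := by rw [measure_not_subset_edgeSet, add_zero]; rfl

/-- **`Ξ^{(0)}_{R,p}(x) ≤ 𝓓_{2,2}(x)` pointwise** for the percolation split (`Ξ^{(0)}_R = Ξ^{(0)} − Ξ^{(0)}_α`).
[cite: FitznerVanDerHofstad2017, Lemma 4.2 (4.23) (arXiv:1506.07977v2 p. 37; EJP 22 (2017) no. 43 p. 34)] -/
theorem percolationNobleSplit_xiR_zero_le_diagD (hd : 2 ≤ d) (p : unitInterval) (hp : p < criticalProbI d)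
    (x : Site d) : (percolationNobleSplit d p hd hp).xiR 0 x ≤ diagD d p 2 2 x := by
  show nobleXiN d p 0 x - (nobleXiA0T d p x).toReal ≤ (diagDT d p 2 2 x).toReal
  rw [nobleXiN_def, sub_le_iff_le_add', ← ENNReal.toReal_add (ne_top_of_le_ne_top (nobleXiT_ne_top hd hp 0 x)
    (nobleXiA0T_le p x)) (diagDT_ne_top p 2 2 x)]
  exact ENNReal.toReal_mono (ENNReal.add_ne_top.2 ⟨ne_top_of_le_ne_top (nobleXiT_ne_top hd hp 0 x)
    (nobleXiA0T_le p x), diagDT_ne_top p 2 2 x⟩) (nobleXiT_zero_le_alpha_add_diagDT p x)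

/-- **[FvdH17, Lemma 4.2, (4.23), first display]** in transfer form: `Σ_x 𝓓_{2,2}(x) ≤ β ⟹ Σ_x Ξ^{(0)}_{R,p}(x) ≤ β`
(with summability), for the percolation split. [cite: FitznerVanDerHofstad2017, Lemma 4.2 (4.23) (arXiv:1506.07977v2 p. 37; EJP 22 (2017) no. 43 p. 34)] -/
theorem FvdH17_L42_d423a (hd : 2 ≤ d) (p : unitInterval) (hp : p < criticalProbI d) {β : ℝ}
    (h : SumLE (diagD d p 2 2) β) : SumLE ((percolationNobleSplit d p hd hp).xiR 0) β := by
  have hle : ∀ x, (percolationNobleSplit d p hd hp).xiR 0 x ≤ diagD d p 2 2 x :=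
    percolationNobleSplit_xiR_zero_le_diagD hd p hp
  have hnn : ∀ x, 0 ≤ (percolationNobleSplit d p hd hp).xiR 0 x := fun x => NobleSplit.xiR_nonneg _ zero_le_one x
  have hs : Summable ((percolationNobleSplit d p hd hp).xiR 0) := h.1.of_nonneg_of_le hnn hle
  exact ⟨hs, (hs.tsum_le_tsum hle h.1).trans h.2⟩

/-- **[FvdH17, Lemma 4.2, (4.23), second display]** in transfer form:
`Σ_x ‖x‖₂² 𝓓_{2,2}(x) ≤ β ⟹ Σ_x ‖x‖₂² Ξ^{(0)}_{R,p}(x) ≤ β`. [cite: FitznerVanDerHofstad2017, Lemma 4.2 (4.23) (arXiv:1506.07977v2 p. 37; EJP 22 (2017) no. 43 p. 34)] -/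
theorem FvdH17_L42_d423b (hd : 2 ≤ d) (p : unitInterval) (hp : p < criticalProbI d) {β : ℝ}
    (h : SumLE (fun x => euclidNorm x ^ 2 * diagD d p 2 2 x) β) :
    SumLE (fun x => euclidNorm x ^ 2 * (percolationNobleSplit d p hd hp).xiR 0 x) β := by
  have hle : ∀ x, euclidNorm x ^ 2 * (percolationNobleSplit d p hd hp).xiR 0 x ≤ euclidNorm x ^ 2 * diagD d p 2 2 x :=
    fun x => mul_le_mul_of_nonneg_left (percolationNobleSplit_xiR_zero_le_diagD hd p hp x) (sq_nonneg _)
  have hnn : ∀ x, 0 ≤ euclidNorm x ^ 2 * (percolationNobleSplit d p hd hp).xiR 0 x :=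
    fun x => mul_nonneg (sq_nonneg _) (NobleSplit.xiR_nonneg _ zero_le_one x)
  have hs : Summable (fun x => euclidNorm x ^ 2 * (percolationNobleSplit d p hd hp).xiR 0 x) :=
    h.1.of_nonneg_of_le hnn hle
  exact ⟨hs, (hs.tsum_le_tsum hle h.1).trans h.2⟩


/-! ### E. `Ξ^{(0),ι}` at `0` and at `e_ι`; (4.31) -/

/-- `{v ↔ v through {e}} = ∅` for `v ≠ e` (the trivial connection `v ↔ v` is realised inside `{e}ᶜ`).
[cite: FitznerVanDerHofstad2017, Definition 3.1 (connection through A) (arXiv:1506.07977v2 p. 21)] -/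
theorem connThrough_singleton_self {v e : Site d} (hve : v ≠ e) : connThrough {e} v v = ∅ := by
  ext ω
  rw [mem_connThrough_iff]
  simp only [Set.mem_empty_iff_false, iff_false, not_and, not_not]
  exact fun _ => ⟨hve, hve, SimpleGraph.Reachable.refl _⟩

/-- `E'(v,v;{e}) = ∅` for `v ≠ e`. [cite: FitznerVanDerHofstad2017, (3.13) (definition of E'(v,y;A)) (arXiv:1506.07977v2 p. 23; EJP 22 (2017) no. 43 p. 22)] -/
theorem laceE_singleton_self_of_ne {v e : Site d} (hve : v ≠ e) : laceE {e} v v = ∅ :=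
  Set.eq_empty_of_subset_empty fun ω hω => by
    rw [← connThrough_singleton_self hve]
    exact ((mem_laceE_iff {e} v v ω).1 hω).1

/-- **`Ξ^{(0),ι}_p(0) = 0`** ([FvdH17] (4.48)): `Ξ^{(0),ι}(0) = P^{(0,e_ι)}(E'(0,0;{e_ι})) = 0`.
[cite: FitznerVanDerHofstad2017, Lemma 4.3 proof, (4.48) (arXiv:1506.07977v2 p. 40)] -/
theorem nobleXiIotaT_zero_at_zero (p : unitInterval) {e : Site d} (he : e ≠ 0) : nobleXiIotaT d p e 0 0 = 0 := by
  rw [nobleXiIotaT_zero_apply, nobleXiBT_zero, laceE_singleton_self_of_ne he.symm, probOff_def]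
  show bondPercolation (zdGraph d) p (offBonds {s((0 : Site d), e)} ⁻¹' ∅) = 0
  rw [Set.preimage_empty, measure_empty]

/-- **`E'(v,e;{e}) = {v ↔ e}`**: a connection to `e` trivially passes through `e`, and a pivotal
bond `(u',v')` for `v → e` has `e ∉ C̃^{(u',v')}(v) ∋ u'`, so `v ↔ u'` is realised in `{e}ᶜ`.
[cite: FitznerVanDerHofstad2017, Lemma 4.3 proof, (4.48) (arXiv:1506.07977v2 p. 40)] -/
theorem laceE_singleton_target (v e : Site d) : laceE {e} v e = openConn v e := by
  refine Set.Subset.antisymm (laceE_subset_openConn {e} v e) fun ω hω => ?_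
  rw [mem_laceE_iff]
  refine ⟨⟨hω, ?_⟩, fun u' v' hpiv hthrough => ?_⟩
  · rintro ⟨-, he', -⟩
    exact he' rfl
  · obtain ⟨-, hu', hv'e⟩ := hpiv
    obtain ⟨-, heC, -⟩ := hv'e
    refine ((mem_connThrough_iff {e} v u' ω).1 hthrough).2 (DCT16.mem_openConnIn_of_pathIn ?_)
    have hpath : PathIn (openGraph (ω \ {s(u', v')})) (restrCluster u' v' v ω) v u' := pathIn_openCluster hu'
    have hCe : restrCluster u' v' v ω ⊆ ({e}ᶜ : Set (Site d)) := fun z hz hze => by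
      rw [Set.mem_singleton_iff] at hze
      rw [hze] at hz
      exact heC hz
    exact (hpath.mono hCe).mono_graph (openGraph_mono Set.sdiff_subset)

/-- **`Ξ^{(0),ι}_p(e_ι) = P_p(0 ↔ e_ι off the bond (0,e_ι))`** ([FvdH17] (4.48) at `x = e_ι`), `[0,∞]`-valued.
[cite: FitznerVanDerHofstad2017, Lemma 4.3 proof, (4.48) (arXiv:1506.07977v2 p. 40)] -/
theorem nobleXiIotaT_zero_at_self (p : unitInterval) (e : Site d) :
    nobleXiIotaT d p e 0 e = probOff d p {s(0, e)} (openConn 0 e) := by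
  rw [nobleXiIotaT_zero_apply, nobleXiBT_zero, laceE_singleton_target]

/-- `0 ∼ e_ι` in `ℤ^d`. [folklore] -/
theorem zdGraph_adj_zero_stepVec (ι : Fin d × Bool) : (zdGraph d).Adj 0 (𝐞 ι) :=
  (zdGraph_adj_iff_stepVec 0 (𝐞 ι)).2 ⟨ι, (zero_add _).symm⟩

/-- **`Ξ^{(0),ι}_p(e_ι) = τ_{3,p}(e_1)`** ([FvdH17] (4.49), first identity): off the bond `(0,e_ι)` an open path
`0 → e_ι` has odd length `≠ 1`, i.e. `≥ 3` (parity), and a simple path of length `≥ 3` never uses that bond.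
[cite: FitznerVanDerHofstad2017, Lemma 4.3 proof, (4.49) (arXiv:1506.07977v2 p. 40)] -/
theorem nobleXiIotaN_zero_at_self (hd : 1 ≤ d) (p : unitInterval) (ι : Fin d × Bool) :
    nobleXiIotaN d p (𝐞 ι) 0 (𝐞 ι) = tauGe d p 3 (unitSite1 d) := by
  rw [← tauGe_stepVec hd p 3 ι, tauGe, measureReal_def, ← probOff_singleton_openConn_eq (zdGraph_adj_zero_stepVec ι) p,
    ← nobleXiIotaT_zero_at_self p (𝐞 ι)]
  rfl

/-- **`Ξ^{(0),ι}_p(0) = 0`**, real-valued ([FvdH17] (4.49), second identity). [cite: FitznerVanDerHofstad2017, Lemma 4.3 proof, (4.49) (arXiv:1506.07977v2 p. 40)] -/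
theorem nobleXiIotaN_zero_at_zero (p : unitInterval) (ι : Fin d × Bool) : nobleXiIotaN d p (𝐞 ι) 0 0 = 0 := by
  show (nobleXiIotaT d p (𝐞 ι) 0 0).toReal = 0
  rw [nobleXiIotaT_zero_at_zero p (percolationStepVec_ne_zero ι), ENNReal.toReal_zero]

/-- **`Ξ^{(0),ι}_{α,I,p}(e_ι) = τ_{3,p}(e_1)`** for the percolation split ([FvdH17] (4.31), first item, with
equality): at `x = e_ι` the second summand of `Ξ^{(0),ι}_{α,I}` vanishes (`e_ι ≁ e_ι`) and the first is `Ξ^{(0),ι}(e_ι)`.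
[cite: FitznerVanDerHofstad2017, Lemma 4.3 (4.31) (arXiv:1506.07977v2 p. 37; EJP 22 (2017) no. 43 p. 35)] -/
theorem percolationNobleSplit_xiIotaAI_at_self (hd : 2 ≤ d) (p : unitInterval) (hp : p < criticalProbI d)
    (ι : Fin d × Bool) : (percolationNobleSplit d p hd hp).xiIotaAI ι (𝐞 ι) = tauGe d p 3 (unitSite1 d) := by
  rw [← nobleXiIotaN_zero_at_self (by omega) p ι]
  show (nobleXiIotaAI0T d p (𝐞 ι) (𝐞 ι)).toReal = (nobleXiIotaT d p (𝐞 ι) 0 (𝐞 ι)).toReal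
  rw [nobleXiIotaAI0T, if_pos rfl, if_neg (SimpleGraph.irrefl _), add_zero]

/-- **[FvdH17, Lemma 4.3, (4.31), first item]** `Ξ^{(0),ι}_{α,I,p}(e_ι) ≤ τ_{3,p}(e_1)` for the percolation split
(field `xiIotaAlphaIAtEi` of `NobleAssumption43At`). [cite: FitznerVanDerHofstad2017, Lemma 4.3 (4.31) (arXiv:1506.07977v2 p. 37; EJP 22 (2017) no. 43 p. 35)] -/
theorem FvdH17_L43_d431a (hd : 2 ≤ d) (p : unitInterval) (hp : p < criticalProbI d) (ι : Fin d × Bool) :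
    (percolationNobleSplit d p hd hp).xiIotaAI ι (𝐞 ι) ≤ tauGe d p 3 (unitSite1 d) :=
  (percolationNobleSplit_xiIotaAI_at_self hd p hp ι).le

/-- **[FvdH17, Lemma 4.3, (4.31), second item]** `Ξ^{(0),ι}_{α,II,p}(0) = 0` for the percolation split
(`Ξ^{(0),ι}_{α,II}(x) = δ_{x,e_ι} Ξ^{(0),ι}(x)` and `0 ≠ e_ι`; field `xiIotaAlphaIIAtZero`).
[cite: FitznerVanDerHofstad2017, Lemma 4.3 (4.31) (arXiv:1506.07977v2 p. 37; EJP 22 (2017) no. 43 p. 35)] -/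
theorem FvdH17_L43_d431b (hd : 2 ≤ d) (p : unitInterval) (hp : p < criticalProbI d) (ι : Fin d × Bool) :
    (percolationNobleSplit d p hd hp).xiIotaAII ι 0 = 0 := by
  show (nobleXiIotaAII0T d p (𝐞 ι) 0).toReal = 0
  rw [nobleXiIotaAII0T, if_neg (percolationStepVec_ne_zero ι).symm, ENNReal.toReal_zero]

/-- `Ξ^{(0),ι}_{α,II,p}(e_κ) = δ_{κ,ι} τ_{3,p}(e_1)` for the percolation split. [cite: FitznerVanDerHofstad2017, Lemma 4.3 (4.31) (arXiv:1506.07977v2 p. 37)] -/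
theorem percolationNobleSplit_xiIotaAII_stepVec (hd : 2 ≤ d) (p : unitInterval) (hp : p < criticalProbI d)
    (ι κ : Fin d × Bool) :
    (percolationNobleSplit d p hd hp).xiIotaAII ι (𝐞 κ) = if κ = ι then tauGe d p 3 (unitSite1 d) else 0 := by
  show (nobleXiIotaAII0T d p (𝐞 ι) (𝐞 κ)).toReal = _
  rw [nobleXiIotaAII0T]
  by_cases h : κ = ι
  · subst h
    rw [if_pos rfl, if_pos rfl, ← nobleXiIotaN_zero_at_self (by omega) p κ]
    rfl
  · rw [if_neg (fun he => h (stepVec_injective' he)), if_neg h, ENNReal.toReal_zero]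

/-- **[FvdH17, Lemma 4.3, (4.31), third item — in the shape of [NoBLE17] (4.39)]**
`Σ_κ Ξ^{(0),ι}_{α,II,p}(e_κ) = τ_{3,p}(e_1)` for every `ι` (field `xiIotaAlphaIISumAroundZero`).  The PRINTED
third item reads `Σ_ι Ξ^{(0),ι}_{α,II,p}(e_ι) ≤ τ_{3,p}(e_1)`; since every summand equals `τ_{3,p}(e_1)` (4.49)
that sum is `2d·τ_{3,p}(e_1)`, so the printed index pattern is a misprint for the quantity Assumption 4.3 of
[NoBLE17] ((4.39) there: `sup_ι Σ_κ Ξ^{(0),ι}_{α,II}(e_κ)`) actually asks for — which is what is proved here.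
[cite: FitznerVanDerHofstad2017, Lemma 4.3 (4.31) (arXiv:1506.07977v2 p. 37; EJP 22 (2017) no. 43 p. 35)]
[cite: FitznerVanDerHofstad2016NoBLE, Assumption 4.3 (4.39) (PTRF 169 p. 1087; arXiv:1506.07969v2 p. 40)] -/
theorem FvdH17_L43_d431c (hd : 2 ≤ d) (p : unitInterval) (hp : p < criticalProbI d) (ι : Fin d × Bool) :
    ∑ κ, (percolationNobleSplit d p hd hp).xiIotaAII ι (𝐞 κ) = tauGe d p 3 (unitSite1 d) := by
  simp only [percolationNobleSplit_xiIotaAII_stepVec hd p hp, Finset.sum_ite_eq', Finset.mem_univ, if_true]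

/-! ### F. (4.32): `Σ_κ Ξ^{(0),ι}_{α,I,p}(e_ι + e_κ) ≤ (2d−1) p τ_{3,p}(e_1)²` -/

/-- The second summand of `Ξ^{(0),ι}_{α,I}` at the neighbour `x = e_ι + e_κ` of `e_ι`.
[cite: FitznerVanDerHofstad2017, §3.4 (3.63) (definition of Ξ^{(0),ι}_{α,I}) (arXiv:1506.07977v2 p. 31; EJP 22 (2017) no. 43 p. 28)] -/
theorem percolationNobleSplit_xiIotaAI_stepVec_add (hd : 2 ≤ d) (p : unitInterval) (hp : p < criticalProbI d)
    (ι κ : Fin d × Bool) :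
    (percolationNobleSplit d p hd hp).xiIotaAI ι (𝐞 ι + 𝐞 κ) =
      (bondPercolation (zdGraph d) p {ω | offBonds {s(0, 𝐞 ι)} ω \ {s(𝐞 ι, 𝐞 ι + 𝐞 κ)} ∈
        connThrough {𝐞 ι} 0 (𝐞 ι + 𝐞 κ) ∧ s(𝐞 ι, 𝐞 ι + 𝐞 κ) ∈ offBonds {s(0, 𝐞 ι)} ω}).toReal := by
  show (nobleXiIotaAI0T d p (𝐞 ι) (𝐞 ι + 𝐞 κ)).toReal = _
  have hne : 𝐞 ι + 𝐞 κ ≠ 𝐞 ι := fun h => percolationStepVec_ne_zero κ (by simpa using h)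
  have hadj : (zdGraph d).Adj (𝐞 ι) (𝐞 ι + 𝐞 κ) := (zdGraph_adj_iff_stepVec _ _).2 ⟨κ, rfl⟩
  rw [nobleXiIotaAI0T, if_neg hne, if_pos hadj, zero_add]

/-- **The event of the second summand of `Ξ^{(0),ι}_{α,I}(x)` (`x ∼ e`, `x ≠ 0`) forces the bond-disjoint
occurrence of `{0 ↔ e off (0,e)}`, `{e ↔ x off (e,x)}` and `{(e,x) occupied}`**: the connection `0 ↔ x`
through `e` in `ω ∖ {(0,e),(e,x)}` is a simple path through `e`, whose two halves are edge-disjoint and avoid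
both bonds. [cite: FitznerVanDerHofstad2017, Lemma 4.3 proof, text between (4.51) and (4.52) (arXiv:1506.07977v2 p. 40; EJP 22 (2017) no. 43 p. 37); (3.63) (p. 31)] -/
theorem xiIotaAI_event_subset_disjointOccurrenceList (e x : Site d) :
    {ω : BondConfig (Site d) | offBonds {s(0, e)} ω \ {s(e, x)} ∈ connThrough {e} 0 x ∧
        s(e, x) ∈ offBonds {s(0, e)} ω} ⊆
      disjointOccurrenceList [{ω | ω \ {s(0, e)} ∈ (openConn 0 e : Set (BondConfig (Site d)))},
        {ω | ω \ {s(e, x)} ∈ (openConn e x : Set (BondConfig (Site d)))}, {ω | s(e, x) ∈ ω}] := by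
  classical
  rintro ω ⟨hct, hb⟩
  have hζω : offBonds {s(0, e)} ω \ {s(e, x)} ⊆ ω := Set.sdiff_subset.trans (offBonds_subset _ _)
  have h0e : s(0, e) ∉ offBonds {s(0, e)} ω \ {s(e, x)} := fun h => h.1.2 rfl
  have hex : s(e, x) ∉ offBonds {s(0, e)} ω \ {s(e, x)} := fun h => h.2 rfl
  obtain ⟨hconn, hnot⟩ := (mem_connThrough_iff {e} 0 x _).1 hct
  obtain ⟨P, hP⟩ := SimpleGraph.Reachable.exists_isPath hconn
  have heP : e ∈ P.support := by
    by_contra heP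
    exact hnot (openConnIn_of_walk P fun y hy hye => heP ((Set.mem_singleton_iff.1 hye) ▸ hy))
  obtain ⟨P₁, P₂, hP12⟩ := SimpleGraph.Walk.mem_support_iff_exists_append.1 heP
  rw [hP12] at hP
  have hnd := hP.isTrail.edges_nodup
  rw [SimpleGraph.Walk.edges_append] at hnd
  have hdis := List.disjoint_of_nodup_append hnd
  have key := mem_disjointOccurrenceList_of_pairwise_disjoint (ω := ω)
    [({ω | ω \ {s(0, e)} ∈ (openConn 0 e : Set (BondConfig (Site d)))}, {f | f ∈ P₁.edges}),
     ({ω | ω \ {s(e, x)} ∈ (openConn e x : Set (BondConfig (Site d)))}, {f | f ∈ P₂.edges}),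
     ({ω | s(e, x) ∈ ω}, ({s(e, x)} : Set (Sym2 (Site d))))] ?_ ?_ ?_ ?_
  · simpa using key
  · intro q hq
    simp only [List.mem_cons, List.not_mem_nil, or_false] at hq
    rcases hq with rfl | rfl | rfl
    · exact isUpperSet_sdiff_mem (isUpperSet_openConn 0 e) _
    · exact isUpperSet_sdiff_mem (isUpperSet_openConn e x) _
    · exact isUpperSet_mem_bond _
  · intro q hq
    simp only [List.mem_cons, List.not_mem_nil, or_false] at hq
    rcases hq with rfl | rfl | rfl
    · show {f | f ∈ P₁.edges} \ {s(0, e)} ∈ (openConn 0 e : Set (BondConfig (Site d)))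
      exact reachable_openGraph_of_walk P₁ fun f hf =>
        ⟨hf, fun h0 => h0e ((Set.mem_singleton_iff.1 h0) ▸ mem_of_mem_walk_edges P₁ hf)⟩
    · show {f | f ∈ P₂.edges} \ {s(e, x)} ∈ (openConn e x : Set (BondConfig (Site d)))
      exact reachable_openGraph_of_walk P₂ fun f hf =>
        ⟨hf, fun h0 => hex ((Set.mem_singleton_iff.1 h0) ▸ mem_of_mem_walk_edges P₂ hf)⟩
    · exact Set.mem_singleton _
  · have hd12 : Disjoint {f | f ∈ P₁.edges} {f | f ∈ P₂.edges} :=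
      Set.disjoint_left.2 fun f hf1 hf2 => hdis hf1 hf2
    have hd13 : Disjoint {f | f ∈ P₁.edges} ({s(e, x)} : Set (Sym2 (Site d))) :=
      Set.disjoint_singleton_right.2 fun h => hex (mem_of_mem_walk_edges P₁ h)
    have hd23 : Disjoint {f | f ∈ P₂.edges} ({s(e, x)} : Set (Sym2 (Site d))) :=
      Set.disjoint_singleton_right.2 fun h => hex (mem_of_mem_walk_edges P₂ h)
    refine List.Pairwise.cons ?_ (List.Pairwise.cons ?_ (List.pairwise_singleton _ _))
    · intro q hq
      simp only [List.mem_cons, List.not_mem_nil, or_false] at hq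
      rcases hq with rfl | rfl
      · exact hd12
      · exact hd13
    · intro q hq
      simp only [List.mem_cons, List.not_mem_nil, or_false] at hq
      subst hq
      exact hd23
  · intro q hq
    simp only [List.mem_cons, List.not_mem_nil, or_false] at hq
    rcases hq with rfl | rfl | rfl
    · exact fun f hf => hζω (mem_of_mem_walk_edges P₁ hf)
    · exact fun f hf => hζω (mem_of_mem_walk_edges P₂ hf)
    · intro f hf
      rw [Set.mem_singleton_iff] at hf
      subst hf
      exact offBonds_subset _ _ hb

/-- **BK bound for one term of (4.32)**: for `e_ι + e_κ ≠ 0`, the second summand of `Ξ^{(0),ι}_{α,I,p}(e_ι+e_κ)` is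
at most `τ_{3,p}(e_1) · τ_{3,p}(e_1) · p` (three bond-disjoint increasing finitary events; parity turns both
off-bond connection functions into `τ_{3,p}`; symmetry moves them to `e_1`).
[cite: FitznerVanDerHofstad2017, Lemma 4.3 (4.32) (arXiv:1506.07977v2 p. 37; EJP 22 (2017) no. 43 p. 35)] -/
theorem measureReal_xiIotaAI_event_le (hd : 1 ≤ d) (p : unitInterval) (ι κ : Fin d × Bool) :
    (bondPercolation (zdGraph d) p).real {ω | offBonds {s(0, 𝐞 ι)} ω \ {s(𝐞 ι, 𝐞 ι + 𝐞 κ)} ∈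
        connThrough {𝐞 ι} 0 (𝐞 ι + 𝐞 κ) ∧ s(𝐞 ι, 𝐞 ι + 𝐞 κ) ∈ offBonds {s(0, 𝐞 ι)} ω} ≤
      tauGe d p 3 (unitSite1 d) * (tauGe d p 3 (unitSite1 d) * p) := by
  classical
  have hadj0 : (zdGraph d).Adj 0 (𝐞 ι) := zdGraph_adj_zero_stepVec ι
  have hadj : (zdGraph d).Adj (𝐞 ι) (𝐞 ι + 𝐞 κ) := (zdGraph_adj_iff_stepVec _ _).2 ⟨κ, rfl⟩
  have h1 : (bondPercolation (zdGraph d) p).real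
      {ω | ω \ {s(0, 𝐞 ι)} ∈ (openConn 0 (𝐞 ι) : Set (BondConfig (Site d)))} = tauGe d p 3 (unitSite1 d) := by
    rw [measureReal_def, measure_sdiff_mem_openConn_eq hadj0 p, ← measureReal_def, measureReal_openConnGe_eq_tauGe,
      sub_zero, tauGe_stepVec hd]
  have h2 : (bondPercolation (zdGraph d) p).real
      {ω | ω \ {s(𝐞 ι, 𝐞 ι + 𝐞 κ)} ∈ (openConn (𝐞 ι) (𝐞 ι + 𝐞 κ) : Set (BondConfig (Site d)))} =
        tauGe d p 3 (unitSite1 d) := by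
    rw [measureReal_def, measure_sdiff_mem_openConn_eq hadj p, ← measureReal_def, measureReal_openConnGe_eq_tauGe,
      add_sub_cancel_left, tauGe_stepVec hd]
  have h3 : (bondPercolation (zdGraph d) p).real {ω | s(𝐞 ι, 𝐞 ι + 𝐞 κ) ∈ ω} = p :=
    bondPercolation_cylinder (zdGraph d) p ((SimpleGraph.mem_edgeSet _).2 hadj)
  calc (bondPercolation (zdGraph d) p).real _
      ≤ (bondPercolation (zdGraph d) p).real (disjointOccurrenceList
          [{ω | ω \ {s(0, 𝐞 ι)} ∈ (openConn 0 (𝐞 ι) : Set (BondConfig (Site d)))},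
           {ω | ω \ {s(𝐞 ι, 𝐞 ι + 𝐞 κ)} ∈ (openConn (𝐞 ι) (𝐞 ι + 𝐞 κ) : Set (BondConfig (Site d)))},
           {ω | s(𝐞 ι, 𝐞 ι + 𝐞 κ) ∈ ω}]) :=
        measureReal_mono (xiIotaAI_event_subset_disjointOccurrenceList (𝐞 ι) (𝐞 ι + 𝐞 κ))
    _ ≤ _ := bk_finitary_list (zdGraph d) p _ (by
          intro A hA
          simp only [List.mem_cons, List.not_mem_nil, or_false] at hA
          rcases hA with rfl | rfl | rfl
          · exact isUpperSet_sdiff_mem (isUpperSet_openConn _ _) _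
          · exact isUpperSet_sdiff_mem (isUpperSet_openConn _ _) _
          · exact isUpperSet_mem_bond _) (by
          intro A hA
          simp only [List.mem_cons, List.not_mem_nil, or_false] at hA
          rcases hA with rfl | rfl | rfl
          · exact isFinitary_sdiff_mem (isFinitary_openConn _ _) _
          · exact isFinitary_sdiff_mem (isFinitary_openConn _ _) _
          · exact isFinitary_mem_bond _)
    _ = tauGe d p 3 (unitSite1 d) * (tauGe d p 3 (unitSite1 d) * p) := by
        simp only [List.map_cons, List.map_nil, List.prod_cons, List.prod_nil, mul_one, h1, h2, h3]

/-- **[FvdH17, Lemma 4.3, (4.32) — in the shape of [NoBLE17] (4.38)]** for the percolation split: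
`Σ_κ Ξ^{(0),ι}_{α,I,p}(e_ι + e_κ) ≤ (2d−1)·p·τ_{3,p}(e_1)²` for every `ι` (field `xiIotaAlphaISumAroundEi`).
The printed display is `Σ_ι Ξ^{(0),ι}_{α,I,p}(e_1+e_ι) ≤ τ_{3,p}(e_1)(2d−1)pτ_{3,p}(e_1)`; by the signed-permutation
symmetry the two index patterns give the same number, and this is the one Assumption 4.3 of [NoBLE17] asks for.
Proof: the term `κ = −ι` vanishes (`x = 0`), each of the other `2d−1` terms is bounded by `measureReal_xiIotaAI_event_le`.
[cite: FitznerVanDerHofstad2017, Lemma 4.3 (4.32) (arXiv:1506.07977v2 p. 37; EJP 22 (2017) no. 43 p. 35)]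
[cite: FitznerVanDerHofstad2016NoBLE, Assumption 4.3 (4.38) (PTRF 169 p. 1087; arXiv:1506.07969v2 p. 40)] -/
theorem FvdH17_L43_d432 (hd : 2 ≤ d) (p : unitInterval) (hp : p < criticalProbI d) (ι : Fin d × Bool) :
    ∑ κ, (percolationNobleSplit d p hd hp).xiIotaAI ι (𝐞 ι + 𝐞 κ) ≤
      (2 * d - 1) * (p : ℝ) * tauGe d p 3 (unitSite1 d) ^ 2 := by
  classical
  have hd1 : 1 ≤ d := by omega
  have hterm : ∀ κ, (percolationNobleSplit d p hd hp).xiIotaAI ι (𝐞 ι + 𝐞 κ) ≤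
      tauGe d p 3 (unitSite1 d) * (tauGe d p 3 (unitSite1 d) * p) := fun κ => by
    rw [percolationNobleSplit_xiIotaAI_stepVec_add]
    exact measureReal_xiIotaAI_event_le hd1 p ι κ
  have hzero : (percolationNobleSplit d p hd hp).xiIotaAI ι (𝐞 ι + 𝐞 (srev ι)) = 0 := by
    rw [percolationNobleSplit_xiIotaAI_stepVec_add]
    have hx0 : 𝐞 ι + 𝐞 (srev ι) = (0 : Site d) := by rw [stepVec_srev, add_neg_cancel]
    rw [hx0, connThrough_singleton_self (percolationStepVec_ne_zero ι).symm]
    simp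
  rw [← Finset.add_sum_erase Finset.univ _ (Finset.mem_univ (srev ι)), hzero, zero_add]
  calc ∑ κ ∈ Finset.univ.erase (srev ι), (percolationNobleSplit d p hd hp).xiIotaAI ι (𝐞 ι + 𝐞 κ)
      ≤ ∑ κ ∈ Finset.univ.erase (srev ι), tauGe d p 3 (unitSite1 d) * (tauGe d p 3 (unitSite1 d) * p) :=
        Finset.sum_le_sum fun κ _ => hterm κ
    _ = (2 * d - 1) * (p : ℝ) * tauGe d p 3 (unitSite1 d) ^ 2 := by
        rw [Finset.sum_const, Finset.card_erase_of_mem (Finset.mem_univ _), Finset.card_univ, Fintype.card_prod,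
          Fintype.card_fin, Fintype.card_bool, nsmul_eq_mul, Nat.cast_sub (by omega), Nat.cast_mul]
        push_cast
        ring

/-! ### G. `Σ_κ Π^{(0),ι,κ}_{α,p}(e_ι) ≤ (2d−2)·p·τ_{3,p}(e_1)` (the overcounting bound behind (4.37)) -/

/-- The event of `Π^{(0),ι,κ}_p(e_ι)/p` ([FvdH17] (3.42)/(4.51) at `x = e_ι`, `e = e_ι`, `e' = e_κ`): off the bond
`(0,e)`, `E'(0,e;{e})` occurs, the bond `(e, e−e')` is not `(0,e)`, and `e − e' ∉ C̃^{(e,e−e')}(0)`.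
[cite: FitznerVanDerHofstad2017, (3.42) (arXiv:1506.07977v2 p. 28; EJP 22 (2017) no. 43 p. 26); Lemma 4.3 proof (4.52) (arXiv v2 p. 40; EJP p. 37)] -/
def piZeroEvent (e e' : Site d) : Set (BondConfig (Site d)) :=
  {ω | s(e, e - e') ∉ ({s(0, e)} : Set (Sym2 (Site d))) ∧ offBonds {s(0, e)} ω ∈ laceE {e} 0 e ∧
    e - e' ∉ restrCluster e (e - e') 0 (offBonds {s(0, e)} ω)}

/-- Membership in `piZeroEvent` (definitional). [cite: FitznerVanDerHofstad2017, (3.42) (arXiv:1506.07977v2 p. 28; EJP 22 (2017) no. 43 p. 26)] -/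
theorem mem_piZeroEvent_iff (e e' : Site d) (ω : BondConfig (Site d)) :
    ω ∈ piZeroEvent e e' ↔ s(e, e - e') ∉ ({s(0, e)} : Set (Sym2 (Site d))) ∧
      offBonds {s(0, e)} ω ∈ laceE {e} 0 e ∧ e - e' ∉ restrCluster e (e - e') 0 (offBonds {s(0, e)} ω) :=
  Iff.rfl

/-- `piZeroEvent e e' ⊆ {0 ↔ e off (0,e)}`. [cite: FitznerVanDerHofstad2017, (3.42) (arXiv:1506.07977v2 p. 28; EJP 22 (2017) no. 43 p. 26)] -/
theorem piZeroEvent_subset_occursOff (e e' : Site d) :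
    piZeroEvent e e' ⊆ occursOff {s(0, e)} (openConn 0 e) :=
  fun _ h => laceE_subset_openConn {e} 0 e h.2.1

/-- `piZeroEvent` is measurable. [folklore] -/
theorem measurableSet_piZeroEvent (e e' : Site d) : MeasurableSet (piZeroEvent e e') := by
  have h1 : Measurable fun ω : BondConfig (Site d) => offBonds {s(0, e)} ω ∈ laceE {e} 0 e :=
    measurableSet_setOf.1 (measurableSet_occursOff {s(0, e)} (measurableSet_laceE {e} 0 e))
  have h2 : Measurable fun ω : BondConfig (Site d) => e - e' ∈ restrCluster e (e - e') 0 (offBonds {s(0, e)} ω) :=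
    measurable_set_iff.1 ((measurable_restrCluster e (e - e') 0).comp (measurable_offBonds {s(0, e)})) (e - e')
  exact measurableSet_setOf.2 (measurable_const.and (h1.and h2.not))

/-- **`Π^{(0),ι,κ}_{α,p}(e_ι) = p · P_p(piZeroEvent e_ι e_κ)`** for the percolation split (`Π_α^{(0),ι,κ}(x) = δ_{x,e_ι}Π^{(0),ι,κ}(x)`).
[cite: FitznerVanDerHofstad2017, §3.4 (3.66) (definition of Π^{(0),ι,κ}_α) (arXiv:1506.07977v2 p. 31; EJP 22 (2017) no. 43 p. 28); (3.42) (arXiv v2 p. 28)] -/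
theorem percolationNobleSplit_piA_at_self (hd : 2 ≤ d) (p : unitInterval) (hp : p < criticalProbI d)
    (ι κ : Fin d × Bool) :
    (percolationNobleSplit d p hd hp).piA ι κ (𝐞 ι) =
      (p : ℝ) * (bondPercolation (zdGraph d) p (piZeroEvent (𝐞 ι) (𝐞 κ))).toReal := by
  show (noblePiA0T d p (𝐞 ι) (𝐞 κ) (𝐞 ι)).toReal = _
  rw [noblePiA0T, if_pos rfl, noblePiT_zero_apply, noblePsiBT_zero, ENNReal.toReal_mul, ENNReal.toReal_ofReal p.2.1]
  rfl

/-- **The overcounting step**: on a configuration of lattice bonds, among the `2d` directions `κ` at most `2d − 2`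
satisfy `piZeroEvent e_ι e_κ` — the direction `κ = ι` (the bond `(e_ι, e_ι − e_ι) = (0,e_ι)` is excluded) and the
direction `κ₀` of the LAST STEP of a simple open path `0 → e_ι` off `(0,e_ι)` (then `e_ι − e_{κ₀} ∈ C̃^{(e_ι,e_ι−e_{κ₀})}(0)`)
both fail, and `κ₀ ≠ ι`. [cite: FitznerVanDerHofstad2017, Lemma 4.3 proof, text after (4.52) ("at least two κ do not contribute") (arXiv:1506.07977v2 p. 40; EJP 22 (2017) no. 43 p. 37)] -/
theorem card_le_of_forall_mem_piZeroEvent {ω : BondConfig (Site d)} (hω : ω ⊆ (zdGraph d).edgeSet)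
    (ι : Fin d × Bool) (s : Finset (Fin d × Bool)) (hs : ∀ κ ∈ s, ω ∈ piZeroEvent (𝐞 ι) (𝐞 κ)) :
    s.card ≤ 2 * d - 2 := by
  classical
  rcases s.eq_empty_or_nonempty with rfl | ⟨κ₁, hκ₁⟩
  · simp
  have hA : offBonds {s(0, 𝐞 ι)} ω ∈ (openConn 0 (𝐞 ι) : Set (BondConfig (Site d))) := by
    rw [← laceE_singleton_target]
    exact (hs κ₁ hκ₁).2.1
  have hζE : offBonds {s(0, 𝐞 ι)} ω ⊆ (zdGraph d).edgeSet := (offBonds_subset _ _).trans hω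
  obtain ⟨P, hP⟩ := SimpleGraph.Reachable.exists_isPath hA
  obtain ⟨a, hea, Q, hPQ⟩ := exists_eq_cons_of_ne P.reverse (percolationStepVec_ne_zero ι)
  have hmem : s(𝐞 ι, a) ∈ offBonds {s(0, 𝐞 ι)} ω := ((openGraph_adj _ _ _).1 hea).1
  have hea' : (zdGraph d).Adj (𝐞 ι) a := (SimpleGraph.mem_edgeSet _).1 (hζE hmem)
  obtain ⟨j, hj⟩ := (zdGraph_adj_iff_stepVec _ _).1 hea'
  have hκ₀ : 𝐞 ι - 𝐞 (srev j) = a := by rw [stepVec_srev, sub_neg_eq_add, hj]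
  have hne : srev j ≠ ι := by
    intro h
    have ha0 : a = 0 := by rw [← hκ₀, h, sub_self]
    rw [ha0] at hmem
    exact hmem.2 (Set.mem_singleton_iff.2 Sym2.eq_swap)
  have hQpath : (SimpleGraph.Walk.cons hea Q).IsPath := hPQ ▸ hP.reverse
  have heQ : 𝐞 ι ∉ Q.support := ((SimpleGraph.Walk.cons_isPath_iff hea Q).1 hQpath).2
  have hnot₀ : ω ∉ piZeroEvent (𝐞 ι) (𝐞 (srev j)) := by
    intro hT
    apply ((mem_piZeroEvent_iff _ _ _).1 hT).2.2
    rw [hκ₀, mem_restrCluster_iff]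
    refine reachable_sdiff_of_walk Q.reverse fun hmem' => heQ ?_
    rw [SimpleGraph.Walk.edges_reverse, List.mem_reverse] at hmem'
    exact Q.fst_mem_support_of_mem_edges hmem'
  have hnotι : ω ∉ piZeroEvent (𝐞 ι) (𝐞 ι) := by
    intro hT
    apply ((mem_piZeroEvent_iff _ _ _).1 hT).1
    rw [sub_self]
    exact Set.mem_singleton_iff.2 Sym2.eq_swap
  calc s.card ≤ ((Finset.univ.erase ι).erase (srev j)).card := Finset.card_le_card fun κ hκ =>
          Finset.mem_erase.2 ⟨fun h => hnot₀ (h ▸ hs κ hκ),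
            Finset.mem_erase.2 ⟨fun h => hnotι (h ▸ hs κ hκ), Finset.mem_univ _⟩⟩
    _ = 2 * d - 2 := by
          rw [Finset.card_erase_of_mem (Finset.mem_erase.2 ⟨hne, Finset.mem_univ _⟩),
            Finset.card_erase_of_mem (Finset.mem_univ _), Finset.card_univ, Fintype.card_prod, Fintype.card_fin,
            Fintype.card_bool]
          omega

/-- **`Σ_κ P_p(piZeroEvent e_ι e_κ) ≤ (2d−2) · P_p(0 ↔ e_ι off (0,e_ι))`** (the overcounting bound integrated).
[cite: FitznerVanDerHofstad2017, Lemma 4.3 proof, text after (4.52) (arXiv:1506.07977v2 p. 40; EJP 22 (2017) no. 43 p. 37)] -/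
theorem sum_measure_piZeroEvent_le (p : unitInterval) (ι : Fin d × Bool) :
    ∑ κ, bondPercolation (zdGraph d) p (piZeroEvent (𝐞 ι) (𝐞 κ)) ≤
      ((2 * d - 2 : ℕ) : ℝ≥0∞) * bondPercolation (zdGraph d) p (occursOff {s(0, 𝐞 ι)} (openConn 0 (𝐞 ι))) := by
  classical
  have hT : ∀ κ, MeasurableSet (piZeroEvent (𝐞 ι) (𝐞 κ)) := fun κ => measurableSet_piZeroEvent _ _
  have hA : MeasurableSet (occursOff {s(0, 𝐞 ι)} (openConn 0 (𝐞 ι))) :=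
    measurableSet_occursOff _ (measurableSet_openConn_holds 0 _)
  have hae : ∀ᵐ ω ∂(bondPercolation (zdGraph d) p), ω ⊆ (zdGraph d).edgeSet :=
    ae_iff.2 (measure_not_subset_edgeSet p)
  calc ∑ κ, bondPercolation (zdGraph d) p (piZeroEvent (𝐞 ι) (𝐞 κ))
      = ∑ κ, ∫⁻ ω, (piZeroEvent (𝐞 ι) (𝐞 κ)).indicator 1 ω ∂(bondPercolation (zdGraph d) p) := by
        simp only [lintegral_indicator_one (hT _)]
    _ = ∫⁻ ω, ∑ κ, (piZeroEvent (𝐞 ι) (𝐞 κ)).indicator 1 ω ∂(bondPercolation (zdGraph d) p) :=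
        (lintegral_finsetSum _ fun κ _ => measurable_one.indicator (hT κ)).symm
    _ ≤ ∫⁻ ω, ((2 * d - 2 : ℕ) : ℝ≥0∞) * (occursOff {s(0, 𝐞 ι)} (openConn 0 (𝐞 ι))).indicator 1 ω
          ∂(bondPercolation (zdGraph d) p) := by
        refine lintegral_mono_ae (hae.mono fun ω hω => ?_)
        simp only [Set.indicator_apply, Pi.one_apply, Finset.sum_boole]
        split_ifs with hωA
        · rw [mul_one]
          exact_mod_cast card_le_of_forall_mem_piZeroEvent hω ι _ fun κ hκ => (Finset.mem_filter.1 hκ).2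
        · have h0 : Finset.univ.filter (fun κ => ω ∈ piZeroEvent (𝐞 ι) (𝐞 κ)) = ∅ :=
            Finset.filter_eq_empty_iff.2 fun κ _ hκ => hωA (piZeroEvent_subset_occursOff _ _ hκ)
          rw [h0]
          simp
    _ = ((2 * d - 2 : ℕ) : ℝ≥0∞) * bondPercolation (zdGraph d) p (occursOff {s(0, 𝐞 ι)} (openConn 0 (𝐞 ι))) := by
        rw [lintegral_const_mul _ (measurable_one.indicator hA), lintegral_indicator_one hA]

/-- **`Σ_κ Π^{(0),ι,κ}_{α,p}(e_ι) ≤ (2d−2) · p · τ_{3,p}(e_1)`** for the percolation split, for every `ι` (field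
`piAlpha_upper` of `NobleAssumption43At`).  This is the bound the PRINTED overcounting argument for (4.37) yields
("for a given configuration at least two κ do not contribute, namely κ = −ι and the direction of the last step
of {0 ↔ e_ι}"; in the notation of the present definitions the first excluded direction is the one with
`e_ι − e_κ = 0`), combined with `P_p(0 ↔ e_ι off (0,e_ι)) = τ_{3,p}(e_1)` (4.49).  The printed right-hand side of
(4.37) is `Σ_κ Π^{(0),ι,κ}_{α,p}(e_1) ≤ 2(d−1) μ_p τ_{3,p}(e_1)` (TeX `\aap` = `μ_p = p·P_p(e_1 ∉ 𝒞(0) | (0,e_1) vacant) ≤ p`,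
§2.4; tree `nobleMu`), i.e. a SMALLER constant than the printed argument delivers (the per-term Harris step gives
`Π^{(0),ι,κ}_p(e_ι) ≤ p·τ_{3,p}(e_1)·P_p(decreasing event | (0,e_ι) vacant) ≤ p τ_{3,p}(e_1)`); that display is NOT
asserted here (see the module docstring, item (4.37)): this theorem is the kernel-checked `(2d−2)·p·τ_{3,p}(e_1)`
version, which is also the value `(2d-2) z G₃` (`z = p`) used by the authors' Mathematica notebook
(`Percolation.nb`, definition `Bound[Pi,alpha,0]`). [cite: FitznerVanDerHofstad2017, Lemma 4.3 (4.37) and its proof (arXiv:1506.07977v2 pp. 38, 40; EJP 22 (2017) no. 43 p. 35)] -/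
theorem FvdH17_L43_piAlpha_sum_le (hd : 2 ≤ d) (p : unitInterval) (hp : p < criticalProbI d) (ι : Fin d × Bool) :
    ∑ κ, (percolationNobleSplit d p hd hp).piA ι κ (𝐞 ι) ≤ (2 * d - 2) * (p : ℝ) * tauGe d p 3 (unitSite1 d) := by
  classical
  have hd1 : 1 ≤ d := by omega
  simp only [percolationNobleSplit_piA_at_self hd p hp]
  rw [← Finset.mul_sum, ← ENNReal.toReal_sum (fun κ _ => measure_ne_top _ _)]
  have h := sum_measure_piZeroEvent_le p ι
  have hA : (bondPercolation (zdGraph d) p (occursOff {s(0, 𝐞 ι)} (openConn 0 (𝐞 ι)))).toReal =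
      tauGe d p 3 (unitSite1 d) := by
    rw [← probOff_def, probOff_singleton_openConn_eq (zdGraph_adj_zero_stepVec ι), ← measureReal_def,
      measureReal_openConnGe_eq_tauGe, sub_zero, tauGe_stepVec hd1]
  calc (p : ℝ) * (∑ κ, bondPercolation (zdGraph d) p (piZeroEvent (𝐞 ι) (𝐞 κ))).toReal
      ≤ (p : ℝ) * (((2 * d - 2 : ℕ) : ℝ≥0∞) *
          bondPercolation (zdGraph d) p (occursOff {s(0, 𝐞 ι)} (openConn 0 (𝐞 ι)))).toReal :=
        mul_le_mul_of_nonneg_left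
          (ENNReal.toReal_mono (ENNReal.mul_ne_top (ENNReal.natCast_ne_top _) (measure_ne_top _ _)) h) p.2.1
    _ = (2 * d - 2) * (p : ℝ) * tauGe d p 3 (unitSite1 d) := by
        rw [ENNReal.toReal_mul, ENNReal.toReal_natCast, hA, Nat.cast_sub (by omega), Nat.cast_mul]
        push_cast
        ring

/-! ### H. The remaining displays of Lemmas 4.2 and 4.3 as NAMED FACTS (verbatim, transfer form)

Conventions for this section.  `S = percolationNobleSplit d p hd hp` is the percolation split of [FvdH17] §3.4
((3.59)–(3.66), arXiv:1506.07977v2 pp. 30–31; EJP p. 28): `S.psiRI 0 κ = Ψ^{(0),κ}_{R,I,p}`, `S.psiRII 0 κ = Ψ^{(0),κ}_{R,II,p}`,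
`S.xiIotaRI ι = Ξ^{(0),ι}_{R,I,p}`, `S.xiIotaRII ι = Ξ^{(0),ι}_{R,II,p}`, `S.piR ι κ = Π^{(0),ι,κ}_{R,p}` (with `e_ι = 𝐞 ι`);
`Ξ^{(0),ι}_p = nobleXiIotaN d p (𝐞 ι) 0`; `μ_p = nobleMu d p` (the TeX macro `\aap` prints `μ_p`, §2.4/(2.18));
`τ_{3,p}(e_1) = tauGe d p 3 (unitSite1 d)`; `D_{j,j} = diagD d p j j` ((4.12), PATH READING); `‖x‖₂ = euclidNorm x`.
TRANSFER FORM: a printed inequality of sums `Σ_x L(x) ≤ C · Σ_x R(x)` between non-negative families is typed as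
"`Σ_x R(x)` summable with sum `≤ β` ⟹ `Σ_x L(x)` summable with sum `≤ C·β`" (`SumLE`), which for non-negative
families is equivalent to the printed comparison of (possibly infinite) sums and avoids the junk value of `∑'`.
Every fact carries the lemma's standing hypothesis `p < p_c` through the argument `hp` (and `2 ≤ d`, under which
the split and `e_1` are defined in the tree).  The displays (4.24) and (4.37) are deliberately NOT typed (module
docstring). -/

/-- **[FvdH17, Lemma 4.2, (4.25)]** — named fact.  Print: "Let `p < p_c`. Then, […] Further, for all `κ`, […]
`Σ_{x∈ℤ^d} ‖x − e_κ‖₂² Ψ^{(0),κ}_{R,I,p}(x) ≤ (p/μ_p) Σ_{x∈ℤ^d} (1 + ‖x‖₂²) D_{1,1}(x)`" (transfer form).  Printed proof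
(arXiv v2 p. 39, after (4.47)): (3.74) `Ψ^{(0),κ}_{R,I} ≤ Ψ^{(0),κ} ≤ (p/μ_p) Ξ^{(0)}`, `‖x − e_κ‖₂² = ‖x‖₂² − 2x_κ + 1` and the
spatial symmetry `Σ_x ‖x−e_κ‖² Ψ^{κ}_{R,I}(x) = (1/2d) Σ_{x,κ}(…)`, under which the `x_κ` term cancels — sound.
[cite: FitznerVanDerHofstad2017, Lemma 4.2 (4.25) (arXiv:1506.07977v2 p. 37; EJP 22 (2017) no. 43 p. 34)] -/
def FvdH17_L42_d425 (d : ℕ) (p : unitInterval) (hd : 2 ≤ d) (hp : p < criticalProbI d) : Prop :=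
  ∀ (κ : Fin d × Bool) (β : ℝ), SumLE (fun x => (1 + euclidNorm x ^ 2) * diagD d p 1 1 x) β →
    SumLE (fun x => euclidNorm (x - 𝐞 κ) ^ 2 * (percolationNobleSplit d p hd hp).psiRI 0 κ x)
      ((p : ℝ) / nobleMu d p * β)

/-- **[FvdH17, Lemma 4.2, (4.26)]** — named fact.  Print: "[…] and
`Σ_{x∈ℤ^d} Ψ^{(0),κ}_{R,II,p}(x) ≤ min{1, (p/μ_p)·(d−1)/d} Σ_{x∈ℤ^d} D_{2,2}(x)`" (for all `κ`; transfer form).  Printed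
proof ((4.45), arXiv v2 p. 39): `Ψ^{(0),κ}_{R,II}(x) = (1−δ_{0,x})(p/μ_p) P_p({0 ←2→ x}∘{x ←2→ 0} ∩ {(x−e_κ) ∉ C̃^{(x,x−e_κ)}(x)})`,
then either the Harris inequality (4.41) (`≤ D_{2,2}(x)·μ_p/p`-type bound giving the `1`) or the overcounting
argument of p. 38 (giving `(p/μ_p)(2d−2)/(2d)`) — sound.
[cite: FitznerVanDerHofstad2017, Lemma 4.2 (4.26) (arXiv:1506.07977v2 p. 37; EJP 22 (2017) no. 43 p. 34)] -/
def FvdH17_L42_d426 (d : ℕ) (p : unitInterval) (hd : 2 ≤ d) (hp : p < criticalProbI d) : Prop :=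
  ∀ (κ : Fin d × Bool) (β : ℝ), SumLE (diagD d p 2 2) β →
    SumLE ((percolationNobleSplit d p hd hp).psiRII 0 κ)
      (min 1 ((p : ℝ) / nobleMu d p * (((d : ℝ) - 1) / d)) * β)

/-- **[FvdH17, Lemma 4.2, (4.27)]** — named fact.  Print: "[…]
`Σ_{x∈ℤ^d} ‖x‖₂² Ψ^{(0),κ}_{R,II,p}(x) ≤ min{1, (p/μ_p)·(d−1)/d} Σ_{x∈ℤ^d} ‖x‖₂² D_{2,2}(x)`" (for all `κ`; transfer form).
Printed proof: as for (4.26), termwise — sound.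
[cite: FitznerVanDerHofstad2017, Lemma 4.2 (4.27) (arXiv:1506.07977v2 p. 37; EJP 22 (2017) no. 43 p. 34)] -/
def FvdH17_L42_d427 (d : ℕ) (p : unitInterval) (hd : 2 ≤ d) (hp : p < criticalProbI d) : Prop :=
  ∀ (κ : Fin d × Bool) (β : ℝ), SumLE (fun x => euclidNorm x ^ 2 * diagD d p 2 2 x) β →
    SumLE (fun x => euclidNorm x ^ 2 * (percolationNobleSplit d p hd hp).psiRII 0 κ x)
      (min 1 ((p : ℝ) / nobleMu d p * (((d : ℝ) - 1) / d)) * β)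

/-- **[FvdH17, Lemma 4.3, (4.28)]** — named fact.  Print: "Let `p < p_c`. Then,
`Σ_{x∈ℤ^d} Ξ^{(0),ι}_p(x) ≤ τ_{3,p}(e_1) (1 + Σ_{x∈ℤ^d} D_{1,1}(x))`" (transfer form).  Printed proof ((4.48)–(4.50),
arXiv v2 p. 40): `Ξ^{(0),ι}(x) = P({0,e_ι} ↔ x ∘ e_ι ⇔ x | (0,e_ι) vacant)`, so `Ξ^{(0),ι}(e_ι) = τ_{3,p}(e_1)`
(`nobleXiIotaN_zero_at_self`), `Ξ^{(0),ι}(0) = 0` (`nobleXiIotaN_zero_at_zero`) and, by the BK inequality,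
`Ξ^{(0),ι}(x) ≤ τ_{3,p}(e_1) D_{1,1}(x − e_ι)` for `x ≠ e_ι, 0` — sound.
[cite: FitznerVanDerHofstad2017, Lemma 4.3 (4.28) (arXiv:1506.07977v2 p. 37; EJP 22 (2017) no. 43 p. 34)] -/
def FvdH17_L43_d428 (d : ℕ) (p : unitInterval) (_hd : 2 ≤ d) (_hp : p < criticalProbI d) : Prop :=
  ∀ (ι : Fin d × Bool) (β : ℝ), SumLE (diagD d p 1 1) β →
    SumLE (nobleXiIotaN d p (𝐞 ι) 0) (tauGe d p 3 (unitSite1 d) * (1 + β))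

/-- **[FvdH17, Lemma 4.3, (4.29)]** — named fact.  Print: "`Σ_{x∈ℤ^d} ‖x − e_ι‖₂² Ξ^{(0),ι}_p(x) ≤ τ_{3,p}(e_1) Σ_{x∈ℤ^d} ‖x‖₂² D_{1,1}(x)`"
(transfer form).  Printed proof: (4.49)–(4.50) and the shift `x ↦ x − e_ι` (the terms `x = e_ι`, `x = 0` carry
weight `0` resp. vanish) — sound.
[cite: FitznerVanDerHofstad2017, Lemma 4.3 (4.29) (arXiv:1506.07977v2 p. 37; EJP 22 (2017) no. 43 p. 34)] -/
def FvdH17_L43_d429 (d : ℕ) (p : unitInterval) (_hd : 2 ≤ d) (_hp : p < criticalProbI d) : Prop :=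
  ∀ (ι : Fin d × Bool) (β : ℝ), SumLE (fun x => euclidNorm x ^ 2 * diagD d p 1 1 x) β →
    SumLE (fun x => euclidNorm (x - 𝐞 ι) ^ 2 * nobleXiIotaN d p (𝐞 ι) 0 x) (tauGe d p 3 (unitSite1 d) * β)

/-- **[FvdH17, Lemma 4.3, (4.30)]** — named fact.  Print: "`Σ_{x∈ℤ^d} ‖x‖₂² Ξ^{(0),ι}_p(x) ≤ τ_{3,p}(e_1) + τ_{3,p}(e_1) Σ_{x∈ℤ^d} (1 + ‖x‖₂²) D_{1,1}(x)`"
(transfer form).  Printed proof ((4.51), arXiv v2 p. 40): apply (4.50), average over `ι`, shift the sum, expand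
`‖x + e_ι‖₂² = ‖x‖₂² + 2x_ι + 1` (the `x_ι` term cancels in the sum over `ι`) — sound.
[cite: FitznerVanDerHofstad2017, Lemma 4.3 (4.30) (arXiv:1506.07977v2 p. 37; EJP 22 (2017) no. 43 p. 34)] -/
def FvdH17_L43_d430 (d : ℕ) (p : unitInterval) (_hd : 2 ≤ d) (_hp : p < criticalProbI d) : Prop :=
  ∀ (ι : Fin d × Bool) (β : ℝ), SumLE (fun x => (1 + euclidNorm x ^ 2) * diagD d p 1 1 x) β →
    SumLE (fun x => euclidNorm x ^ 2 * nobleXiIotaN d p (𝐞 ι) 0 x)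
      (tauGe d p 3 (unitSite1 d) + tauGe d p 3 (unitSite1 d) * β)

/-- **[FvdH17, Lemma 4.3, (4.33)]** — named fact.  Print: "[…] and `Σ_{x∈ℤ^d} Ξ^{(0),ι}_{R,I,p}(x) ≤ τ_{3,p}(e_1) Σ_{x∈ℤ^d} D_{2,2}(x)`"
(transfer form).  Printed proof (arXiv v2 p. 40): in the remainder `Ξ^{(0),ι}_{R,I}` the value at `e_ι` and the
direct-bond realisations of `{e_ι ⇔ x}` have been extracted ((3.63)), so the connection `e_ι ⇔ x` uses two paths of
length `≥ 2` each; BK as in (4.50) — sound.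
[cite: FitznerVanDerHofstad2017, Lemma 4.3 (4.33) (arXiv:1506.07977v2 p. 38; EJP 22 (2017) no. 43 p. 35)] -/
def FvdH17_L43_d433 (d : ℕ) (p : unitInterval) (hd : 2 ≤ d) (hp : p < criticalProbI d) : Prop :=
  ∀ (ι : Fin d × Bool) (β : ℝ), SumLE (diagD d p 2 2) β →
    SumLE ((percolationNobleSplit d p hd hp).xiIotaRI ι) (tauGe d p 3 (unitSite1 d) * β)

/-- **[FvdH17, Lemma 4.3, (4.34)]** — named fact.  Print: "`Σ_{x∈ℤ^d} ‖x − e_ι‖₂² Ξ^{(0),ι}_{R,I,p}(x) ≤ τ_{3,p}(e_1) Σ_{x∈ℤ^d} ‖x‖₂² D_{2,2}(x)`"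
(transfer form).  Printed proof: as for (4.33) with the shift `x ↦ x − e_ι` — sound.
[cite: FitznerVanDerHofstad2017, Lemma 4.3 (4.34) (arXiv:1506.07977v2 p. 38; EJP 22 (2017) no. 43 p. 35)] -/
def FvdH17_L43_d434 (d : ℕ) (p : unitInterval) (hd : 2 ≤ d) (hp : p < criticalProbI d) : Prop :=
  ∀ (ι : Fin d × Bool) (β : ℝ), SumLE (fun x => euclidNorm x ^ 2 * diagD d p 2 2 x) β →
    SumLE (fun x => euclidNorm (x - 𝐞 ι) ^ 2 * (percolationNobleSplit d p hd hp).xiIotaRI ι x)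
      (tauGe d p 3 (unitSite1 d) * β)

/-- **[FvdH17, Lemma 4.3, (4.35)]** — named fact.  Print: "`Σ_{x∈ℤ^d} Ξ^{(0),ι}_{R,II,p}(x) ≤ τ_{3,p}(e_1) Σ_{x∈ℤ^d} D_{1,1}(x)`"
(transfer form).  Printed proof (arXiv v2 p. 40): `Ξ^{(0),ι}_{R,II} = Ξ^{(0),ι} − δ_{·,e_ι} Ξ^{(0),ι}(e_ι)` ((3.64)–(3.65)),
then (4.49)–(4.50) "in the same way as (4.28)–(4.30)" — sound.
[cite: FitznerVanDerHofstad2017, Lemma 4.3 (4.35) (arXiv:1506.07977v2 p. 38; EJP 22 (2017) no. 43 p. 35)] -/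
def FvdH17_L43_d435 (d : ℕ) (p : unitInterval) (hd : 2 ≤ d) (hp : p < criticalProbI d) : Prop :=
  ∀ (ι : Fin d × Bool) (β : ℝ), SumLE (diagD d p 1 1) β →
    SumLE ((percolationNobleSplit d p hd hp).xiIotaRII ι) (tauGe d p 3 (unitSite1 d) * β)

/-- **[FvdH17, Lemma 4.3, (4.36)]** — named fact.  Print: "`Σ_{x∈ℤ^d} ‖x‖₂² Ξ^{(0),ι}_{R,II,p}(x) ≤ τ_{3,p}(e_1) Σ_{x∈ℤ^d} (1 + ‖x‖₂²) D_{1,1}(x)`"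
(transfer form).  Printed proof: as for (4.30), the extracted term `x = e_ι` being exactly the printed summand
`τ_{3,p}(e_1)` that (4.36) no longer carries — sound.
[cite: FitznerVanDerHofstad2017, Lemma 4.3 (4.36) (arXiv:1506.07977v2 p. 38; EJP 22 (2017) no. 43 p. 35)] -/
def FvdH17_L43_d436 (d : ℕ) (p : unitInterval) (hd : 2 ≤ d) (hp : p < criticalProbI d) : Prop :=
  ∀ (ι : Fin d × Bool) (β : ℝ), SumLE (fun x => (1 + euclidNorm x ^ 2) * diagD d p 1 1 x) β →
    SumLE (fun x => euclidNorm x ^ 2 * (percolationNobleSplit d p hd hp).xiIotaRII ι x)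
      (tauGe d p 3 (unitSite1 d) * β)

/-- **[FvdH17, Lemma 4.3, (4.38)]** — named fact.  Print: "The coefficient `Π^{(0),ι,κ}_p` can be bounded by […]
`Σ_{x,κ} Π^{(0),ι,κ}_{R,p}(x) ≤ (2d)² p τ_{3,p}(e_1) Σ_{x∈ℤ^d} D_{1,1}(x)`" (`ι` fixed; transfer form: every
`Π^{(0),ι,κ}_{R,p}` summable and the double sum bounded).  Printed proof ((4.53), arXiv v2 p. 40): in `Π_R` one has
`x ≠ e_ι`, and termwise `Π^{(0),ι,κ}_p(x) ≤ p τ_{3,p}(e_ι) P(e_ι ⇔ x)` (drop the decreasing event, BK off the vacant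
bond); the printed middle expression sums over BOTH `ι` and `κ`, so it bounds the full triple sum, of which the
printed left side (and the tree's per-`κ` sums over `ι`, see `FvdH17_L43_d453`) are parts — sound.
[cite: FitznerVanDerHofstad2017, Lemma 4.3 (4.38) (arXiv:1506.07977v2 p. 38; EJP 22 (2017) no. 43 p. 35)] -/
def FvdH17_L43_d438 (d : ℕ) (p : unitInterval) (hd : 2 ≤ d) (hp : p < criticalProbI d) : Prop :=
  ∀ (ι : Fin d × Bool) (β : ℝ), SumLE (diagD d p 1 1) β →
    (∀ κ, Summable ((percolationNobleSplit d p hd hp).piR ι κ)) ∧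
      ∑ κ, ∑' x, (percolationNobleSplit d p hd hp).piR ι κ x ≤
        (2 * d) ^ 2 * (p : ℝ) * tauGe d p 3 (unitSite1 d) * β

/-- **[FvdH17, proof of Lemma 4.3, display (4.53)]** — named fact (a displayed inequality of the published proof,
quoted because it is the per-`κ` form the NoBLE analysis consumes).  Print: "In the remainder term `Π^{(0),ι,κ}_{R,p}`
we know that `x ≠ e_ι`, so that `Σ_{x,ι} Π^{(0),ι,κ}_{R,p}(x) ≤ p Σ_{ι,κ} τ_{3,p}(e_ι) Σ_{x≠e_ι} P(e_ι ⇔ x)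
= (2d)² p τ_{3,p}(e_1) Σ_{x≠0} D_{1,1}(x)`" (`κ` fixed on the left; transfer form; `D_{1,1}(0) = 0` by
`diagDT_zero_of_ne`, so `Σ_{x≠0} D_{1,1} = Σ_x D_{1,1}`).  Soundness: as for (4.38).
[cite: FitznerVanDerHofstad2017, Lemma 4.3, proof, (4.53) (arXiv:1506.07977v2 p. 40; EJP 22 (2017) no. 43 p. 37)] -/
def FvdH17_L43_d453 (d : ℕ) (p : unitInterval) (hd : 2 ≤ d) (hp : p < criticalProbI d) : Prop :=
  ∀ (κ : Fin d × Bool) (β : ℝ), SumLE (diagD d p 1 1) β →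
    (∀ ι, Summable ((percolationNobleSplit d p hd hp).piR ι κ)) ∧
      ∑ ι, ∑' x, (percolationNobleSplit d p hd hp).piR ι κ x ≤
        (2 * d) ^ 2 * (p : ℝ) * tauGe d p 3 (unitSite1 d) * β

/-- **[FvdH17, Lemma 4.3, (4.39)]** — named fact.  Print:
"`Σ_{x,ι,κ} ‖x − e_ι − e_κ‖₂² Π^{(0),ι,κ}_{R,I,p}(x) ≤ (2d)² p τ_{3,p}(e_1) Σ_{x∈ℤ^d} (1 + ‖x‖₂²) D_{1,1}(x)`" (the subscript
`R,I` on `Π` is the paper's; `Π^{(0),ι,κ}` has the single remainder `Π_R` of (3.66), which is what is meant; transfer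
form).  Printed proof ((4.54), arXiv v2 p. 40): termwise bound as in (4.53), shift, `‖x − e_κ‖₂² = ‖x‖₂² + 1 − 2x_κ`
with the `x_κ` term cancelling in the sum over `κ` — sound.
[cite: FitznerVanDerHofstad2017, Lemma 4.3 (4.39) (arXiv:1506.07977v2 p. 38; EJP 22 (2017) no. 43 p. 35)] -/
def FvdH17_L43_d439 (d : ℕ) (p : unitInterval) (hd : 2 ≤ d) (hp : p < criticalProbI d) : Prop :=
  ∀ (β : ℝ), SumLE (fun x => (1 + euclidNorm x ^ 2) * diagD d p 1 1 x) β →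
    (∀ ι κ, Summable (fun x => euclidNorm (x - 𝐞 ι - 𝐞 κ) ^ 2 * (percolationNobleSplit d p hd hp).piR ι κ x)) ∧
      ∑ ι, ∑ κ, ∑' x, euclidNorm (x - 𝐞 ι - 𝐞 κ) ^ 2 * (percolationNobleSplit d p hd hp).piR ι κ x ≤
        (2 * d) ^ 2 * (p : ℝ) * tauGe d p 3 (unitSite1 d) * β

end Lattice

end Literature.Probability.FitznerVanDerHofstad2017

end
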